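import Mathlib
import Summits.ResolutionOfSingularities.ResolutionOfSingularities.Theorems.RadicialJungCleanModelsStubLooseCleanOfGiraud15
import Literature.AlgebraicGeometry.Resolution.GiraudFunctionNormalForm
import Literature.AlgebraicGeometry.Resolution.LocalBlowup
import Literature.AlgebraicGeometry.Resolution.TranscendenceDefect
import Literature.RingTheory.PBasis.KimuraNiitsuma1980
import Summits.ResolutionOfSingularities.ResolutionOfSingularities.Theorems.RadicialJungCleanModelsPBasisAtClosedPoint
import Summits.ResolutionOfSingularities.ResolutionOfSingularities.Theorems.RadicialJungCleanModelsPBasisMonomialIdeal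
import Summits.ResolutionOfSingularities.ResolutionOfSingularities.Theorems.RadicialJungCleanModelsPBasisDualDerivations
import Literature.RingTheory.PBasis.KimuraNiitsuma1980Theorem31
import Literature.AlgebraicGeometry.Resolution.RegularLocalRingsProofs
import Mathlib.RingTheory.Jacobson.Ring
import Literature.AlgebraicGeometry.Resolution.FieldsJ2
import Literature.AlgebraicGeometry.Resolution.AffineDomainDimension
import Literature.AlgebraicGeometry.Resolution.ProjectiveSpaceRegular
import Literature.AlgebraicGeometry.Resolution.ResolutionLU
import Literature.AlgebraicGeometry.CossartPiltant200819.Cor46Cofinality2008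
import Literature.AlgebraicGeometry.CossartPiltant200819.Thm21Verbatim2008
import Literature.AlgebraicGeometry.Motives.RatFnSpec
import Summits.ResolutionOfSingularities.ResolutionOfSingularities.Theorems.RadicialJungCleanModelsCleanLU3ArcPackage
import Summits.ResolutionOfSingularities.ResolutionOfSingularities.Theorems.RadicialJungCleanModelsCleanLU2Extraction
import Summits.ResolutionOfSingularities.ResolutionOfSingularities.Theorems.RadicialJungCleanModelsStubCleanCharts3
import HarnessLib

/-!
# [OURS · CANDIDATE · counted 0] lens 5 (res-B-lens-5 g11): the `k = k̄` ANCHOR of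
# `stub_cleanLU3DefectNonDiscrete` (:219) — EVERY prime `p`, EVERY valuation class — on ONE named fact:
# Cossart 1987 (ν-termination in dimension 3 over an algebraically closed field), pointwise read through
# Giraud 1983 Prop. 1.5 (the tree's `Giraud15NormalFormAt`), along the valuation

bears_on: LADDER-RESOLUTION:B · crux stmt-ResolutionOfSingularities-0549 (`Theses.Descent.DescentPerfectToAll`),
customer stub :219 of `Cruxes/CleanModels/Lines/Sketch.lean` (stmt-…-15917, line lead res-B-lead-1).  Nothing here
proves resolution in characteristic `p`; resolution in char `p` is NOT proved.  Crux workfile (evidence), not a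
`Theorems/` proposal.

## What this file certifies (kernel, sorry-free, standard axioms)

* §1 `Cossart1987Giraud15AlongValuationAt p` — NAMED-FACT SHAPE (Giraud-form variant): for `k` ALGEBRAICALLY CLOSED
  of characteristic `p`, a finitely generated `k`-model `A ⊆ O_v` of a threefold function field `K`, regular of
  dimension `3` at the (closed) centre of the zero-dimensional valuation ring `O`, and `f ∈ A` not a `p`-th power in
  `K`: there is a finitely generated `A' ⊇ A` inside `O` whose local ring at the centre `S' := locAtCentre A' O` is
  regular and in which `f` is in GIRAUD NORMAL FORM (the tree's `Literature.….Giraud15NormalFormAt p`).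
  = Cossart 1987 (below) ∘ finitely many further blow-ups of exponent-one strata along `v` ∘ LEMMA G (memo §2.3, §4).
* §4 `cleanLU3Defect_algClosed_of_cossart1987` — THE `k̄`-SLICE OF :219 (statement = :219 VERBATIM with the single
  extra instance binder `[IsAlgClosed k]`) from that one hypothesis, through the tree's LANDED dimension-free read-off
  ✓ `stub_looseCleanOfGiraud15` and the packaging `f := b^p·g₀ ∈ A`, `c := (c₀, c₁ b, 0, …, 0)` (§3
  `concl_of_looseCleanRep`).
* §5 `Cossart1987NuZeroAlongValuationAt p` — NAMED-FACT SHAPE, LITERAL: same binders, conclusion `NuZeroAt f` at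
  `S'` = Cossart's «`J(X(n), f, E(n)) = 𝒪_{X(n)}`, i.e. `ν(X(n)) = 0`» read at the centre of `v` (PRINT: V. Cossart,
  *Forme normale d'une fonction sur un k-schéma de dimension 3 et de caractéristique p > 0*, Travaux en Cours 22
  (1987) [Cos87a] / thèse d'État, Orsay 1987 [Cos87b]; restated and globalised in Q. Posva, arXiv:2405.05735 (2024),
  App. A §A.1.1–A.1.3 [held text, PDF p.32–33: «Cossart proves the following: if dim X = 3, there exists a modification
  X(n) of (X, f, ∅) such that J(X(n), f, E(n)) = 𝒪_{X(n)}. Equivalently, we eventually have ν(X(n)) = 0.»] and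
  Claim 5.1.2 [p.26]) ∘ routine affine-chart plumbing along `v` (valuative criterion + affine cover; cf. the landed
  dimension-two plumbing ✓ `exists_fg_regular_of_hasResolution`).  `NuZeroReadOffAlongValuationAt p` — the pointwise
  read-off «`ν = 0` ⇒ loosely clean» over ANY ground field (memo §4 LEMMA G, Zariski-local; PROVED IN KERNEL in §9, rev 5;
  its dimension-two cousins are landed: ✓ `giraud15NormalFormAt_of_criticalPrimes_eq₂/₁`).
  `cleanLU3Defect_algClosed_of_nuZero` — THE `k̄`-SLICE OF :219 from the literal fact + that support item (kernel).
* §6 `CossartNuZeroAlongValuationAtPerfect p` — the PERFECT-field version of the literal fact: a RESEARCH PROP (OURS, open, not in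
  print — memo §5 «F-eq»: Cossart's centres along `v` chosen Gal(k̄/k)-stably), and `cleanLU3Defect_perfect_of_equivariantCossart` —
  the kernel composition F-eq + LEMMA G ⇒ :219 verbatim with `[PerfectField k]` (every `p`, every class).  §7 `Cossart1987Thm` — the
  GLOBAL scheme-level named-fact shape (twin of the tree's `Giraud1983Thm24`: dimension `3`, finite type over `k = k̄`, pointwise
  conclusion `NuZeroAt`); the along-`v` fact of §5 = this ∘ routine plumbing — PROVED IN KERNEL in §10 (rev 6).
* §8 the prover-facing SPLIT of LEMMA G in the tree idiom: (G-pb) `exists_isPBasisOver_locAtCentre` — KERNEL, any field `k`: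
  a `p`-basis `Γ ⊇ {t}` of `S'` over `S'^p` at a maximal centre (✓ `exists_isPBasisOver_containing_rsop`, Kimura–Niitsuma 3.4,
  landed) — and (G-alg) `NuZeroReadOffOfPBasis p` (OURS: the ring-level read-off over a `p`-basis, memo §4 (i)–(iv); engine
  ✓ `term_mem_of_mul_derivation_sum_mem`), with the kernel glue `nuZeroReadOff_of_pBasis : (G-alg) → NuZeroReadOffAlongValuationAt p`
  — the along-`v` read-off is therefore stated for EVERY field `k` (rev 4: `[PerfectField k]` dropped).
* §9 (rev 5) **(G-alg) IN KERNEL**: `ReadOff.readOff_core` proves `NuZeroReadOffOfPBasis p`; hence `nuZeroReadOffAlongValuationAt_holds`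
  (LEMMA G along `v`, every `k`), `cleanLU3Defect_algClosed_of_cossart1987NuZero` — THE `k̄`-SLICE OF :219 (every `p`, every class)
  MODULO THE LITERAL PRINT FACT `Cossart1987NuZeroAlongValuationAt p` ALONE — and `cleanLU3Defect_perfect_of_equivariantCossartNuZero`
  (perfect `k`, modulo the research Prop F-eq alone).  The only non-literature input left on the `k̄`-slice is NONE; the only input is print.
* §11 (rev 8) `cleanLU3_algClosed_of_cossart1987Thm` — over `k̄` the SAME chain gives the WHOLE `cleanLU3_of_stubs` statement (Sketch :279,
  all classes, hypotheses up to `g₀ ∉ K^p`; the input of ✓ `cleanCharts3_of_cleanLU3ZeroDim`) verbatim + `[IsAlgClosed k]`, mod `Cossart1987Thm` alone.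
* rev 7: `Cossart1987Thm` carries `[IsSeparated sX]` («regular VARIETY over `k̄`», Posva A.1) — verbatim-or-weaker than print.
* rev 9: `Cossart1987Thm` carries `CP2008.IsQuasiProjectiveOver sX →` (Posva §2.1 (a): variety = integral QUASI-PROJECTIVE `k`-scheme of
  finite type; the tree's verbatim idiom of `CP2008` Thm 2.1, `Thm21Verbatim2008.lean` :175), discharged on `Spec A₁` in §10 by
  ✓ `CP2008.isQuasiProjectiveOver_of_isAffine` — INPUTS NOTE l.38119 / R326 / TRIAGE-114; corollaries unchanged.
* rev 10: §12 — `cleanCharts3ZeroDim_fibred` (the landed stub 4a ✓ `cleanCharts3_of_cleanLU3ZeroDim` with `p, k, K` FIXED; landed proof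
  verbatim) and `cleanCharts3_algClosed_of_cossart1987Thm (h : Cossart1987Thm)` = stub 4a's conclusion verbatim + `[IsAlgClosed k]`: the
  `k̄`-anchor propagated one node up the lead's skeleton (clean CHARTS over `k̄` modulo the global print theorem alone).
* rev 11: §13 — ALL fields at once: `AbsNuZeroAlongValuationAt p` («F-abs»: the along-`v` `ν = 0` shape with NO condition on `k`; `NuZeroAt`
  uses absolute derivations = CP's `k₀`-frame), PRINT exactly over `k̄`, OPEN otherwise; kernel compositions `cleanLU3_of_absNuZero` (= Sketch :279
  VERBATIM, no extra binder) and `cleanCharts3_of_absNuZero` (= ✓ stub 4a's conclusion verbatim, no extra binder); trivial slices to §5/§6.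
* rev 12: §14 — alignment with Sketch rev 25 (3b936b273599a7ba): the NARROWED stub :238 (+ `hdiv` «no divisorial coarsening») verbatim + `[IsAlgClosed k]`
  mod `Cossart1987Thm`, and verbatim (every `k`) mod F-abs, a fortiori; line numbers elsewhere in this file are rev-24 (:219 ↦ rev-25 :268 composition /
  :238 narrowed stub; :279 ↦ :334, statement byte-identical).
* §10 (rev 6) **GLOBAL ⟹ ALONG `v` IN KERNEL**: `cossart1987NuZeroAlongValuationAt_of_thm : Cossart1987Thm → Cossart1987NuZeroAlongValuationAt p`
  (regular affine neighbourhood `exists_regularAffineModel₃` ✓J-2 over fields; `NuZeroAt.of_ringEquiv`; the lead's LANDED extraction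
  ✓ `exists_model_of_proper_birational` = valuative criterion + stalk iso + function-field identification); hence
  `cleanLU3Defect_algClosed_of_cossart1987Thm` — THE `k̄`-SLICE OF :219 (every `p`, every class) MODULO THE GLOBAL LITERAL PRINT
  THEOREM `Cossart1987Thm` ALONE, typed exactly like the tree's consumed `Giraud1983Thm24`.
* rev 4: every fact / research Prop carries a `(_ : Fact p.Prime)` guard (INPUTS R313 recommendation; junk parameters p ∉ primes
  otherwise make the along-`v` Props vacuous / junk-true).
* In all three slices the hypotheses «no best `p`-th-power approximation», «transcendence defect ≠ 0», «not discrete of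
  rank one» of :219 are NOT used: over `k̄` the stub holds at EVERY zero-dimensional valuation with a regular
  three-dimensional centre — all classes (A), (B-rr1), (B-rr2), (C-div), (C-curve) of the lead's census, every `p` —
  modulo the named fact (and, for the literal variant, the OURS read-off).

What is NOT here (memo `KBAR-anchor-Cossart87-lens5-g11.md` §5–§6): the transfer `k̄ → k perfect` (= a
Gal(k̄/k)-equivariant choice of Cossart's centres along `v`; OPEN — the one missing input for the perfect-field residual
of :219) and the imperfect-`k` residual (untouched).  The étale caveat of the g5 STUBPLAN (Posva's «étale-locally
t^p + x^a») is DISSOLVED: `ν = 0` is an equality of ideals (Zariski) and LEMMA G reads the loosely clean form off it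
Zariski-locally when the residue field is perfect.
-/

noncomputable section

set_option linter.unusedVariables false
set_option linter.dupNamespace false -- mandated namespace of this single-conjunct summit

open IsLocalRing
open Literature.AlgebraicGeometry.Resolution
open Summit.ResolutionOfSingularities.ResolutionOfSingularities.Theorems.RadicialJung.CleanModels
open Literature.RingTheory.PBasis

namespace Summit.ResolutionOfSingularities.ResolutionOfSingularities.Cruxes.DescentPerfectToAll.CpSibling.KbarAnchor

/-! ## 1. The named fact, along the valuation (Cossart 1987 ⊕ Giraud 1983 Prop. 1.5, `k` algebraically closed) -/

/-- NAMED-FACT SHAPE — **Cossart 1987 along a zero-dimensional valuation, `k = k̄`** (print: [Cos87a]/[Cos87b] main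
theorem = Posva arXiv:2405.05735 App. A §A.1.3 p.33 + Claim 5.1.2 p.26, pointwise via Giraud 1983 Prop. 1.5;
∘ routine affine-chart plumbing along `v`).  Users take `(h : Cossart1987Giraud15AlongValuationAt p)`.
[cite: Posva2024 arXiv:2405.05735, App. A §A.1.3 and Claim 5.1.2; Giraud1983, Prop. 1.5] -/
def Cossart1987Giraud15AlongValuationAt (p : ℕ) : Prop :=
  ∀ (_ : Fact p.Prime) (k : Type) [Field k] [CharP k p] [IsAlgClosed k] (K : Type) [Field K] [Algebra k K]
    (O : ValuationSubring K) (A : Subalgebra k K), A.toSubring ≤ O.toSubring → A.FG → IsFractionRing A K →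
    ringKrullDim A ≤ 3 → IsRegularLocalRing (locAtCentre A.toSubring O) →
    ringKrullDim (locAtCentre A.toSubring O) = 3 →
    (∀ (T : Subring K) (hT : T ≤ O.toSubring), A.toSubring ≤ T → (subringCentre T O hT).IsMaximal) →
    ∀ f : K, f ∈ A → (∀ c : K, c ^ p ≠ f) →
    ∃ (A' : Subalgebra k K), A'.toSubring ≤ O.toSubring ∧ A ≤ A' ∧ A'.FG ∧
    ∃ (_ : IsRegularLocalRing (locAtCentre A'.toSubring O)) (hf : f ∈ locAtCentre A'.toSubring O),
      Giraud15NormalFormAt p (⟨f, hf⟩ : ↥(locAtCentre A'.toSubring O))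

/-! ## 2. Packaging lemmas -/

variable {K : Type} [Field K]

/-- The two-term representative: with `c = (c₀, c₁', 0, …, 0)`, `∑ c_j^p g₀^j = c₀^p + c₁'^p g₀`. [folklore] -/
theorem sum_two_eq {p : ℕ} [hp : Fact p.Prime] (g₀ c₀ c₁' : K) :
    (∑ j : Fin p, (fun j : Fin p => if (j : ℕ) = 0 then c₀ else if (j : ℕ) = 1 then c₁' else 0) j ^ p *
        g₀ ^ (j : ℕ)) = c₀ ^ p + c₁' ^ p * g₀ := by
  let i₀ : Fin p := ⟨0, hp.out.pos⟩
  let i₁ : Fin p := ⟨1, hp.out.one_lt⟩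
  rw [Finset.sum_eq_add i₀ i₁ (by simp [i₀, i₁, Fin.ext_iff])]
  · simp only [i₀, i₁, if_true, one_ne_zero, if_false, pow_zero, mul_one, pow_one]
  · rintro j - ⟨hj₀, hj₁⟩
    have hj₀' : (j : ℕ) ≠ 0 := fun h => hj₀ (Fin.ext h)
    have hj₁' : (j : ℕ) ≠ 1 := fun h => hj₁ (Fin.ext h)
    simp [hj₀', hj₁', zero_pow hp.out.ne_zero]
  all_goals simp

/-- `b^p g₀ ∈ A` for some nonzero `b ∈ A` (clearing the denominator of `g₀ ∈ K = Frac A`). [folklore] -/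
theorem exists_pow_mul_mem {k : Type} [Field k] [Algebra k K] (p : ℕ) (hp : p.Prime)
    (A : Subalgebra k K) [IsFractionRing A K] (g₀ : K) :
    ∃ b : K, b ≠ 0 ∧ b ∈ A ∧ b ^ p * g₀ ∈ A := by
  obtain ⟨a, b, hb, hab⟩ := IsFractionRing.div_surjective (A := A) g₀
  have hab' : (a : K) / (b : K) = g₀ := hab
  have hb0 : (b : K) ≠ 0 := fun h => nonZeroDivisors.ne_zero hb (Subtype.ext h)
  refine ⟨b, hb0, b.2, ?_⟩
  have : (b : K) ^ p * g₀ = (a : K) * (b : K) ^ (p - 1) := by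
    obtain ⟨q, hq⟩ : ∃ q, p = q + 1 := ⟨p - 1, (Nat.sub_add_cancel hp.one_lt.le).symm⟩
    rw [← hab', hq, Nat.add_sub_cancel, pow_succ]
    field_simp
  rw [this]
  exact A.mul_mem a.2 (A.pow_mem b.2 _)

/-- `locAtCentre A' O` has fraction field `K` when `A ≤ A'` and `Frac A = K`. [folklore] -/
theorem isFractionRing_locAtCentre {k : Type} [Field k] [Algebra k K] {A A' : Subalgebra k K}
    [hfrac : IsFractionRing A K] (hAA' : A ≤ A') (O : ValuationSubring K) :
    IsFractionRing ↥(locAtCentre A'.toSubring O) K := by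
  refine IsFractionRing.of_field _ K fun z => ?_
  obtain ⟨a, b, hb, hab⟩ := IsFractionRing.div_surjective (A := A) z
  have ha' : (a : K) ∈ locAtCentre A'.toSubring O := le_locAtCentre _ O (show (a : K) ∈ A'.toSubring from hAA' a.2)
  have hb' : (b : K) ∈ locAtCentre A'.toSubring O := le_locAtCentre _ O (show (b : K) ∈ A'.toSubring from hAA' b.2)
  exact ⟨⟨a, ha'⟩, ⟨b, hb'⟩, hab.symm⟩

/-! ## 3. The loosely-clean disjunction at a local subring, and the packaging lemma -/

/-- The three «loosely clean» exits of :219 for the two-term representative `c₀^p + c₁^p f` of the `K^p`-line of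
`f` at the local subring `S ⊆ K` (exactly the conclusion shape of ✓ `stub_looseCleanOfGiraud15`). [folklore] -/
def LooseCleanRepAt (p : ℕ) (S : Subring K) [IsLocalRing S] (f : K) : Prop :=
  ∃ c₀ c₁ : K, c₁ ≠ 0 ∧
  ((∃ (d' m : ℕ) (hmd : m ≤ d') (t' : Fin d' → S) (a' : Fin m → ℕ) (w : S), IsUnit w ∧
      Ideal.span (Set.range t') = maximalIdeal S ∧ ringKrullDim S = (d' : WithBot ℕ∞) ∧ 0 < m ∧
      (∀ i, ¬ p ∣ a' i) ∧ c₀ ^ p + c₁ ^ p * f = (w : K) * ∏ i : Fin m, ((t' (Fin.castLE hmd i) : S) : K) ^ (a' i)) ∨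
   (∃ w : S, IsUnit w ∧ c₀ ^ p + c₁ ^ p * f = (w : K) ∧ ∀ c : S, w - c ^ p ∉ maximalIdeal S) ∨
   (∃ s c : S, c₀ ^ p + c₁ ^ p * f = (s : K) ∧ s - c ^ p ∈ maximalIdeal S ∧ s - c ^ p ∉ maximalIdeal S ^ 2))

/-- PACKAGING (kernel): a regular chart `A' ⊇ A` inside `O` at which `f = b^p g₀` (`b ≠ 0`) has a loosely clean
two-term representative yields the conclusion of :219 for `g₀`, with `c := (c₀, c₁ b, 0, …, 0)`. [folklore] -/
theorem concl_of_looseCleanRep {p : ℕ} (hp : p.Prime) {k : Type} [Field k] [Algebra k K]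
    (O : ValuationSubring K) (A A' : Subalgebra k K) (hA'O : A'.toSubring ≤ O.toSubring) (hAA' : A ≤ A')
    (hA'fg : A'.FG) [hreg' : IsRegularLocalRing (locAtCentre A'.toSubring O)] (g₀ b : K) (hb0 : b ≠ 0)
    (hrep : LooseCleanRepAt p (locAtCentre A'.toSubring O) (b ^ p * g₀)) :
    ∃ (A' : Subalgebra k K), A'.toSubring ≤ O.toSubring ∧ A ≤ A' ∧ A'.FG ∧
    ∃ (_ : IsRegularLocalRing (locAtCentre A'.toSubring O)) (c : Fin p → K), (∃ j : Fin p, (j : ℕ) ≠ 0 ∧ c j ≠ 0) ∧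
    ((∃ (d m : ℕ) (hmd : m ≤ d) (t : Fin d → ↥(locAtCentre A'.toSubring O)) (a : Fin m → ℕ) (u : ↥(locAtCentre A'.toSubring O)), IsUnit u ∧
    Ideal.span (Set.range t) = IsLocalRing.maximalIdeal ↥(locAtCentre A'.toSubring O) ∧
    ringKrullDim ↥(locAtCentre A'.toSubring O) = (d : WithBot ℕ∞) ∧ 0 < m ∧ (∀ i, ¬ p ∣ a i) ∧
    (∑ j : Fin p, c j ^ p * g₀ ^ (j : ℕ)) = (u : K) * ∏ i : Fin m, ((t (Fin.castLE hmd i) : ↥(locAtCentre A'.toSubring O)) : K) ^ (a i)) ∨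
    (∃ u : ↥(locAtCentre A'.toSubring O), IsUnit u ∧ (∑ j : Fin p, c j ^ p * g₀ ^ (j : ℕ)) = (u : K) ∧
    ∀ c' : ↥(locAtCentre A'.toSubring O), u - c' ^ p ∉ IsLocalRing.maximalIdeal ↥(locAtCentre A'.toSubring O)) ∨
    (∃ s c' : ↥(locAtCentre A'.toSubring O), (∑ j : Fin p, c j ^ p * g₀ ^ (j : ℕ)) = (s : K) ∧
    s - c' ^ p ∈ IsLocalRing.maximalIdeal ↥(locAtCentre A'.toSubring O) ∧
    s - c' ^ p ∉ IsLocalRing.maximalIdeal ↥(locAtCentre A'.toSubring O) ^ 2)) := by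
  classical
  haveI : Fact p.Prime := ⟨hp⟩
  obtain ⟨c₀, c₁, hc₁, hforms⟩ := hrep
  refine ⟨A', hA'O, hAA', hA'fg, hreg',
    fun j : Fin p => if (j : ℕ) = 0 then c₀ else if (j : ℕ) = 1 then c₁ * b else 0, ?_, ?_⟩
  · refine ⟨⟨1, hp.one_lt⟩, one_ne_zero, ?_⟩
    simp only [one_ne_zero, if_false, if_true]
    exact mul_ne_zero hc₁ hb0
  have hsum : (∑ j : Fin p, (fun j : Fin p => if (j : ℕ) = 0 then c₀ else if (j : ℕ) = 1 then c₁ * b else 0) j ^ p *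
      g₀ ^ (j : ℕ)) = c₀ ^ p + c₁ ^ p * (b ^ p * g₀) := by
    rw [sum_two_eq, mul_pow]; ring
  rw [hsum]
  rcases hforms with ⟨d', m, hmd, t', a', w, hw, ht', hd', hm, ha', heq⟩ | ⟨w, hw, heq, hres⟩ | ⟨s, c', heq, hm1, hm2⟩
  · exact Or.inl ⟨d', m, hmd, t', a', w, hw, ht', hd', hm, ha', heq⟩
  · exact Or.inr (Or.inl ⟨w, hw, heq, hres⟩)
  · exact Or.inr (Or.inr ⟨s, c', heq, hm1, hm2⟩)

/-! ## 4. The `k̄`-slice of :219 from the Giraud-form fact (read-off LANDED: ✓ `stub_looseCleanOfGiraud15`) -/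

/-- **THE `k̄`-SLICE OF `stub_cleanLU3DefectNonDiscrete` (:219)** — :219 verbatim with the one extra binder
`[IsAlgClosed k]`, for EVERY prime `p` and EVERY valuation class, from `Cossart1987Giraud15AlongValuationAt p` alone:
clear the denominator (`f := b^p g₀ ∈ A`, not a `p`-th power), take the regular chart `A'` of the fact with `f` in
Giraud normal form at `S' = locAtCentre A' O`, read off a loosely clean representative `c₀^p + c₁^p f` (`c₁ ≠ 0`) by the
landed dimension-free ✓ `stub_looseCleanOfGiraud15`, and repackage with `c := (c₀, c₁ b, 0, …, 0)`.  The hypotheses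
`hdefect`, `htd`, `hndisc` are carried for the interface and not used. [folklore] -/
theorem cleanLU3Defect_algClosed_of_cossart1987 (p : ℕ) (hC : Cossart1987Giraud15AlongValuationAt p) :
    p.Prime →
    ∀ (k : Type) [Field k] [CharP k p] [IsAlgClosed k] (K : Type) [Field K] [Algebra k K]
    (O : ValuationSubring K) (A : Subalgebra k K), A.toSubring ≤ O.toSubring → A.FG → IsFractionRing A K →
    ringKrullDim A ≤ 3 → IsRegularLocalRing (locAtCentre A.toSubring O) →
    ringKrullDim (locAtCentre A.toSubring O) = 3 →
    (∀ (T : Subring K) (hT : T ≤ O.toSubring), A.toSubring ≤ T → (subringCentre T O hT).IsMaximal) →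
    ∀ g₀ : K, (∀ c : K, c ^ p ≠ g₀) →
    (∀ f₀ : K, ∃ f₁ : K, O.valuation (g₀ - f₁ ^ p) < O.valuation (g₀ - f₀ ^ p)) →
    (∀ hk : ∀ c : k, algebraMap k K c ∈ O, transcendenceDefect k O hk ≠ 0) →
    ¬ (∃ π : K, π ≠ 0 ∧ (∀ x : K, O.valuation x < 1 → O.valuation x ≤ O.valuation π) ∧
      (∀ x : K, x ≠ 0 → ∃ n : ℕ, O.valuation π ^ n ≤ O.valuation x)) →
    ∃ (A' : Subalgebra k K), A'.toSubring ≤ O.toSubring ∧ A ≤ A' ∧ A'.FG ∧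
    ∃ (_ : IsRegularLocalRing (locAtCentre A'.toSubring O)) (c : Fin p → K), (∃ j : Fin p, (j : ℕ) ≠ 0 ∧ c j ≠ 0) ∧
    ((∃ (d m : ℕ) (hmd : m ≤ d) (t : Fin d → ↥(locAtCentre A'.toSubring O)) (a : Fin m → ℕ) (u : ↥(locAtCentre A'.toSubring O)), IsUnit u ∧
    Ideal.span (Set.range t) = IsLocalRing.maximalIdeal ↥(locAtCentre A'.toSubring O) ∧
    ringKrullDim ↥(locAtCentre A'.toSubring O) = (d : WithBot ℕ∞) ∧ 0 < m ∧ (∀ i, ¬ p ∣ a i) ∧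
    (∑ j : Fin p, c j ^ p * g₀ ^ (j : ℕ)) = (u : K) * ∏ i : Fin m, ((t (Fin.castLE hmd i) : ↥(locAtCentre A'.toSubring O)) : K) ^ (a i)) ∨
    (∃ u : ↥(locAtCentre A'.toSubring O), IsUnit u ∧ (∑ j : Fin p, c j ^ p * g₀ ^ (j : ℕ)) = (u : K) ∧
    ∀ c' : ↥(locAtCentre A'.toSubring O), u - c' ^ p ∉ IsLocalRing.maximalIdeal ↥(locAtCentre A'.toSubring O)) ∨
    (∃ s c' : ↥(locAtCentre A'.toSubring O), (∑ j : Fin p, c j ^ p * g₀ ^ (j : ℕ)) = (s : K) ∧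
    s - c' ^ p ∈ IsLocalRing.maximalIdeal ↥(locAtCentre A'.toSubring O) ∧
    s - c' ^ p ∉ IsLocalRing.maximalIdeal ↥(locAtCentre A'.toSubring O) ^ 2)) := by
  intro hp k _ _ _ K _ _ O A hAO hAfg hfrac hdimA hreg hdim3 hzd g₀ hg₀ hdefect htd hndisc
  classical
  haveI : Fact p.Prime := ⟨hp⟩
  haveI : CharP K p := charP_of_injective_algebraMap (algebraMap k K).injective p
  haveI := hfrac
  -- (1) clear the denominator: `f = b^p g₀ ∈ A`, not a `p`-th power
  obtain ⟨b, hb0, hbA, hfA⟩ := exists_pow_mul_mem p hp A g₀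
  set f : K := b ^ p * g₀ with hfdef
  have hf : ∀ c : K, c ^ p ≠ f := by
    intro c hc
    apply hg₀ (c / b)
    rw [div_pow, hc, hfdef, mul_comm, mul_div_cancel_right₀ _ (pow_ne_zero _ hb0)]
  -- (2) the named fact: a regular chart `A'` with `f` in Giraud normal form at the centre
  obtain ⟨A', hA'O, hAA', hA'fg, hreg', hfS, hG⟩ :=
    hC ⟨hp⟩ k K O A hAO hAfg hfrac hdimA hreg hdim3 hzd f hfA hf
  haveI : IsRegularLocalRing ↥(locAtCentre A'.toSubring O) := hreg'
  haveI : IsFractionRing ↥(locAtCentre A'.toSubring O) K := isFractionRing_locAtCentre hAA' O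
  -- (3) read off a loosely clean representative (landed, dimension-free)
  obtain ⟨d, r, hrd, t, g, u, a, ht, hd, -, hfeq, hc⟩ := hG
  obtain ⟨c₀, c₁, hc₁, hforms⟩ :=
    stub_looseCleanOfGiraud15 (O := ↥(locAtCentre A'.toSubring O)) (K := K) p hp hrd t ht hd g u a ⟨f, hfS⟩ hfeq
      (hc.imp_right fun h => h)
  have hfK : algebraMap (↥(locAtCentre A'.toSubring O)) K ⟨f, hfS⟩ = f := rfl
  rw [hfK] at hforms
  -- (4) repackage
  refine concl_of_looseCleanRep (hreg' := hreg') hp O A A' hA'O hAA' hA'fg g₀ b hb0 ⟨c₀, c₁, hc₁, ?_⟩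
  rcases hforms with ⟨d', m, hmd, t', a', w, hw, ht', hd', hm, ha', heq⟩ | ⟨w, hw, heq, hres⟩ | ⟨s, c', heq, hm1, hm2⟩
  · refine Or.inl ⟨d', m, hmd, t', a', w, hw, ht', hd', hm, ha', ?_⟩
    rw [heq, map_mul, map_prod]
    simp_rw [map_pow]
    rfl
  · exact Or.inr (Or.inl ⟨w, hw, heq, hres⟩)
  · exact Or.inr (Or.inr ⟨s, c', heq, hm1, hm2⟩)

/-! ## 5. The LITERAL print conclusion (Cossart's `ν = 0`) and the pointwise read-off as a separate support item

Cossart's theorem concludes `J(X(n), f, E(n)) = 𝒪_{X(n)}` (Posva A.1.3), i.e. at every point `x` of `X(n)` the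
log-Jacobian ideal `𝒥(X(n), f, E(n))_x` — the image of `ev_f` on `D(X, E) = {∂ ∈ Der(𝒪_X) | ∂(I_E) ⊆ I_E}` (A.1.1 p.32),
`E(n)` simple normal crossings, its components through `x` cut out by members `t_0, …, t_{e-1}` of a regular system of
parameters (for such `E`, `∂(I_E) ⊆ I_E` iff `t_i ∣ ∂ t_i` for every `i < e`) — EQUALS its divisorial part
`H(X(n), f, E(n))_x = (∏ t_i^{b_i})` («`ν(x) = ord_x J = 0`»).  `NuZeroAt` types exactly this at a local ring and
`Cossart1987NuZeroAlongValuationAt p` is the literal fact along `v` (printed ∘ routine chart plumbing, no further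
mathematics).  The pointwise step «`ν = 0` ⇒ loosely clean» at a regular local ring with PERFECT residue field which is
free over its `p`-th powers on the monomials of a regular system of parameters (memo §4, LEMMA G — a Zariski-local
statement; Posva p.33 only records the étale-local monomial form `t^p + x^a`, `a ≢ 0 mod p`, Claim 5.1.2 (o)) is the
separate support Prop `NuZeroReadOffAlongValuationAt p` (OURS; size M; NOT the tree's `Giraud15NormalFormAt`: e.g.
`f = x·y`, `p = 2`, `E ⊇ {x, y}` has `ν = 0` and is loosely clean (form (1), exponents `(1,1)`), but is NOT in Giraud's
normal form `g^p + u·∏ tᵢ^{aᵢ}`, `aᵢ ≥ 2` — memo §2.3).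
-/

/-- **`ν(x) = 0` for `(f, E)` at the local ring `S = 𝒪_{X,x}`** (Cossart 1987; Posva App. A §A.1.1–A.1.3): for some
regular system of parameters `t` of `S` (`d = dim S`) whose first `e` members cut out the boundary `E` through `x`,
the ideal generated by the values `D f` of the derivations `D ∈ Der_ℤ(S)` logarithmic along `E`
(`t_i ∣ D t_i`, `i < e`) is the principal monomial ideal `(∏_{i<e} t_i^{b_i})`.
[cite: Posva2024 arXiv:2405.05735, App. A §A.1.1 and §A.1.3] -/
def NuZeroAt {S : Type} [CommRing S] [IsLocalRing S] (f : S) : Prop :=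
  ∃ (d e : ℕ) (hed : e ≤ d) (t : Fin d → S) (b : Fin e → ℕ),
    Ideal.span (Set.range t) = maximalIdeal S ∧ ringKrullDim S = (d : WithBot ℕ∞) ∧
    Ideal.span {v : S | ∃ D : Derivation ℤ S S,
        (∀ i : Fin e, t (Fin.castLE hed i) ∣ D (t (Fin.castLE hed i))) ∧ D f = v} =
      Ideal.span {∏ i : Fin e, t (Fin.castLE hed i) ^ b i}

/-- NAMED-FACT SHAPE, LITERAL — **Cossart 1987 along a zero-dimensional valuation, `k = k̄`, conclusion `ν = 0`**
(Posva arXiv:2405.05735 App. A §A.1.3 p.33 «if `dim X = 3`, there exists a modification `X(n)` of `(X, f, ∅)` such that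
`J(X(n), f, E(n)) = 𝒪_{X(n)}`», after [Cos87a] = V. Cossart, *Forme normale d'une fonction sur un k-schéma de
dimension 3 et de caractéristique p > 0*, Travaux en Cours 22 (1987) 1–21 and [Cos87b] thèse d'État, Orsay 1987;
∘ routine affine-chart plumbing along `v`: restrict to a regular affine neighbourhood `X = Spec A_s` of the closed
centre, take the centre `x_n` of `v` on the projective `X(n) → X` and an affine chart `Spec A' ∋ x_n`).
[cite: Posva2024 arXiv:2405.05735, App. A §A.1.3; Cossart1987] -/
def Cossart1987NuZeroAlongValuationAt (p : ℕ) : Prop :=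
  ∀ (_ : Fact p.Prime) (k : Type) [Field k] [CharP k p] [IsAlgClosed k] (K : Type) [Field K] [Algebra k K]
    (O : ValuationSubring K) (A : Subalgebra k K), A.toSubring ≤ O.toSubring → A.FG → IsFractionRing A K →
    ringKrullDim A ≤ 3 → IsRegularLocalRing (locAtCentre A.toSubring O) →
    ringKrullDim (locAtCentre A.toSubring O) = 3 →
    (∀ (T : Subring K) (hT : T ≤ O.toSubring), A.toSubring ≤ T → (subringCentre T O hT).IsMaximal) →
    ∀ f : K, f ∈ A → (∀ c : K, c ^ p ≠ f) →
    ∃ (A' : Subalgebra k K), A'.toSubring ≤ O.toSubring ∧ A ≤ A' ∧ A'.FG ∧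
    ∃ (_ : IsRegularLocalRing (locAtCentre A'.toSubring O)) (hf : f ∈ locAtCentre A'.toSubring O),
      NuZeroAt (⟨f, hf⟩ : ↥(locAtCentre A'.toSubring O))

/-- SUPPORT (OURS; size M) — **the pointwise read-off «`ν = 0` ⇒ loosely clean» along a zero-dimensional valuation,
over ANY ground field of characteristic `p`** (memo §4 LEMMA G; Zariski-local; rev 4: the `[PerfectField k]` binder of
rev 1–3 is dropped — §8): at the regular local ring `S' = locAtCentre A' O` of a finitely generated model at a closed centre
(`S'` has a `p`-basis `Γ ⊇ {t}` over `S'^p`, ✓ `exists_isPBasisOver_locAtCentre`; `Der_ℤ(S')` is dual to `Γ`), `ν = 0` for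
`f ∉ K^p` gives a loosely clean two-term representative `c₀^p + c₁^p f`, `c₁ ≠ 0` (forms (1)/(2)/(3); `c₁ := ∏_{i} t_i^{-⌊b_i/p⌋}`,
`c₀ := -c₁ F₀`, `F₀^p` = the constant coefficient of `f` on the monomial basis).  = `nuZeroReadOff_of_pBasis` ∘ (G-alg). [folklore] -/
def NuZeroReadOffAlongValuationAt (p : ℕ) : Prop :=
  ∀ (_ : Fact p.Prime) (k : Type) [Field k] [CharP k p] (K : Type) [Field K] [Algebra k K]
    (O : ValuationSubring K) (A' : Subalgebra k K) (hA'O : A'.toSubring ≤ O.toSubring), A'.FG → IsFractionRing A' K →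
    (subringCentre A'.toSubring O hA'O).IsMaximal →
    ∀ (_ : IsRegularLocalRing (locAtCentre A'.toSubring O)) (f : K) (hf : f ∈ locAtCentre A'.toSubring O),
    (∀ c : K, c ^ p ≠ f) →
    NuZeroAt (⟨f, hf⟩ : ↥(locAtCentre A'.toSubring O)) →
    LooseCleanRepAt p (locAtCentre A'.toSubring O) f

/-- `A'` has fraction field `K` when `A ≤ A'` and `Frac A = K`. [folklore] -/
theorem isFractionRing_of_le' {k : Type} [Field k] [Algebra k K] {A A' : Subalgebra k K}
    [hfrac : IsFractionRing A K] (hAA' : A ≤ A') : IsFractionRing A' K := by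
  refine IsFractionRing.of_field _ K fun z => ?_
  obtain ⟨a, b, hb, hab⟩ := IsFractionRing.div_surjective (A := A) z
  exact ⟨⟨a, hAA' a.2⟩, ⟨b, hAA' b.2⟩, hab.symm⟩

/-- **THE `k̄`-SLICE OF :219 FROM THE LITERAL FACT** (`ν = 0`, Cossart 1987 via Posva A.1.3) and the OURS read-off
support item (LEMMA G) — kernel composition; `htd`, `hdefect`, `hndisc` unused. [folklore] -/
theorem cleanLU3Defect_algClosed_of_nuZero (p : ℕ) (hN : Cossart1987NuZeroAlongValuationAt p)
    (hR : NuZeroReadOffAlongValuationAt p) :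
    p.Prime →
    ∀ (k : Type) [Field k] [CharP k p] [IsAlgClosed k] (K : Type) [Field K] [Algebra k K]
    (O : ValuationSubring K) (A : Subalgebra k K), A.toSubring ≤ O.toSubring → A.FG → IsFractionRing A K →
    ringKrullDim A ≤ 3 → IsRegularLocalRing (locAtCentre A.toSubring O) →
    ringKrullDim (locAtCentre A.toSubring O) = 3 →
    (∀ (T : Subring K) (hT : T ≤ O.toSubring), A.toSubring ≤ T → (subringCentre T O hT).IsMaximal) →
    ∀ g₀ : K, (∀ c : K, c ^ p ≠ g₀) →
    (∀ f₀ : K, ∃ f₁ : K, O.valuation (g₀ - f₁ ^ p) < O.valuation (g₀ - f₀ ^ p)) →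
    (∀ hk : ∀ c : k, algebraMap k K c ∈ O, transcendenceDefect k O hk ≠ 0) →
    ¬ (∃ π : K, π ≠ 0 ∧ (∀ x : K, O.valuation x < 1 → O.valuation x ≤ O.valuation π) ∧
      (∀ x : K, x ≠ 0 → ∃ n : ℕ, O.valuation π ^ n ≤ O.valuation x)) →
    ∃ (A' : Subalgebra k K), A'.toSubring ≤ O.toSubring ∧ A ≤ A' ∧ A'.FG ∧
    ∃ (_ : IsRegularLocalRing (locAtCentre A'.toSubring O)) (c : Fin p → K), (∃ j : Fin p, (j : ℕ) ≠ 0 ∧ c j ≠ 0) ∧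
    ((∃ (d m : ℕ) (hmd : m ≤ d) (t : Fin d → ↥(locAtCentre A'.toSubring O)) (a : Fin m → ℕ) (u : ↥(locAtCentre A'.toSubring O)), IsUnit u ∧
    Ideal.span (Set.range t) = IsLocalRing.maximalIdeal ↥(locAtCentre A'.toSubring O) ∧
    ringKrullDim ↥(locAtCentre A'.toSubring O) = (d : WithBot ℕ∞) ∧ 0 < m ∧ (∀ i, ¬ p ∣ a i) ∧
    (∑ j : Fin p, c j ^ p * g₀ ^ (j : ℕ)) = (u : K) * ∏ i : Fin m, ((t (Fin.castLE hmd i) : ↥(locAtCentre A'.toSubring O)) : K) ^ (a i)) ∨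
    (∃ u : ↥(locAtCentre A'.toSubring O), IsUnit u ∧ (∑ j : Fin p, c j ^ p * g₀ ^ (j : ℕ)) = (u : K) ∧
    ∀ c' : ↥(locAtCentre A'.toSubring O), u - c' ^ p ∉ IsLocalRing.maximalIdeal ↥(locAtCentre A'.toSubring O)) ∨
    (∃ s c' : ↥(locAtCentre A'.toSubring O), (∑ j : Fin p, c j ^ p * g₀ ^ (j : ℕ)) = (s : K) ∧
    s - c' ^ p ∈ IsLocalRing.maximalIdeal ↥(locAtCentre A'.toSubring O) ∧
    s - c' ^ p ∉ IsLocalRing.maximalIdeal ↥(locAtCentre A'.toSubring O) ^ 2)) := by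
  intro hp k _ _ _ K _ _ O A hAO hAfg hfrac hdimA hreg hdim3 hzd g₀ hg₀ hdefect htd hndisc
  classical
  haveI : Fact p.Prime := ⟨hp⟩
  haveI := hfrac
  obtain ⟨b, hb0, hbA, hfA⟩ := exists_pow_mul_mem p hp A g₀
  set f : K := b ^ p * g₀ with hfdef
  have hf : ∀ c : K, c ^ p ≠ f := by
    intro c hc
    apply hg₀ (c / b)
    rw [div_pow, hc, hfdef, mul_comm, mul_div_cancel_right₀ _ (pow_ne_zero _ hb0)]
  obtain ⟨A', hA'O, hAA', hA'fg, hreg', hfS, hN'⟩ := hN ⟨hp⟩ k K O A hAO hAfg hfrac hdimA hreg hdim3 hzd f hfA hf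
  haveI : IsFractionRing A' K := isFractionRing_of_le' hAA'
  have hmax : (subringCentre A'.toSubring O hA'O).IsMaximal := hzd A'.toSubring hA'O (fun x hx => hAA' hx)
  haveI : IsRegularLocalRing ↥(locAtCentre A'.toSubring O) := hreg'
  exact concl_of_looseCleanRep (hreg' := hreg') hp O A A' hA'O hAA' hA'fg g₀ b hb0
    (hR ⟨hp⟩ k K O A' hA'O hA'fg inferInstance hmax hreg' f hfS hf hN')


/-! ## 6. The PERFECT-field residual: the one missing input, typed, and its kernel composition

Over a perfect ground field `k ≠ k̄` nothing is in print (memo §5): Cossart's centres are not functorial (Posva Rem. 5.1.8,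
[Cos87b, II.C.5.4]), so Galois-stability of the centres met along `v` is a genuine missing input.  `CossartNuZeroAlongValuationAtPerfect p`
types exactly that input — it is NOT a named fact (not in print; an OURS research Prop, «F-eq» of the memo) — and
`cleanLU3Defect_perfect_of_equivariantCossart` is the kernel composition: F-eq + LEMMA G ⇒ :219 over every PERFECT `k`, every `p`,
every class.  (Memo §5 reduces F-eq to «Cossart 1987 over `k̄` with Gal(k̄/k)-stable centres along `v̄`» by base change and faithfully
flat descent; that reduction is prose, not kernel.)
-/

/-- RESEARCH PROP (OURS, OPEN — NOT in print; memo §5 «F-eq») — **Cossart's `ν = 0` along a zero-dimensional valuation over a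
PERFECT ground field**: the binders of `Cossart1987NuZeroAlongValuationAt` with `[PerfectField k]` in place of `[IsAlgClosed k]`.
[conjecture: lens-5 g11, memo KBAR-anchor-Cossart87 §5] -/
def CossartNuZeroAlongValuationAtPerfect (p : ℕ) : Prop :=
  ∀ (_ : Fact p.Prime) (k : Type) [Field k] [CharP k p] [PerfectField k] (K : Type) [Field K] [Algebra k K]
    (O : ValuationSubring K) (A : Subalgebra k K), A.toSubring ≤ O.toSubring → A.FG → IsFractionRing A K →
    ringKrullDim A ≤ 3 → IsRegularLocalRing (locAtCentre A.toSubring O) →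
    ringKrullDim (locAtCentre A.toSubring O) = 3 →
    (∀ (T : Subring K) (hT : T ≤ O.toSubring), A.toSubring ≤ T → (subringCentre T O hT).IsMaximal) →
    ∀ f : K, f ∈ A → (∀ c : K, c ^ p ≠ f) →
    ∃ (A' : Subalgebra k K), A'.toSubring ≤ O.toSubring ∧ A ≤ A' ∧ A'.FG ∧
    ∃ (_ : IsRegularLocalRing (locAtCentre A'.toSubring O)) (hf : f ∈ locAtCentre A'.toSubring O),
      NuZeroAt (⟨f, hf⟩ : ↥(locAtCentre A'.toSubring O))

/-- The `k̄` fact is the special case of the perfect-field Prop (an algebraically closed field is perfect). [folklore] -/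
theorem cossart1987NuZero_of_perfect (p : ℕ) (h : CossartNuZeroAlongValuationAtPerfect p) :
    Cossart1987NuZeroAlongValuationAt p := by
  intro hp k _ _ _ K _ _ O A hAO hAfg hfrac hdimA hreg hdim3 hzd f hfA hf
  exact h hp k K O A hAO hAfg hfrac hdimA hreg hdim3 hzd f hfA hf

/-- **THE PERFECT-FIELD SLICE OF :219** (statement = :219 verbatim with the one extra binder `[PerfectField k]`; every `p`, every
class) from the research Prop F-eq and the read-off LEMMA G — kernel composition; `htd`, `hdefect`, `hndisc` unused. [folklore] -/
theorem cleanLU3Defect_perfect_of_equivariantCossart (p : ℕ) (hN : CossartNuZeroAlongValuationAtPerfect p)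
    (hR : NuZeroReadOffAlongValuationAt p) :
    p.Prime →
    ∀ (k : Type) [Field k] [CharP k p] [PerfectField k] (K : Type) [Field K] [Algebra k K]
    (O : ValuationSubring K) (A : Subalgebra k K), A.toSubring ≤ O.toSubring → A.FG → IsFractionRing A K →
    ringKrullDim A ≤ 3 → IsRegularLocalRing (locAtCentre A.toSubring O) →
    ringKrullDim (locAtCentre A.toSubring O) = 3 →
    (∀ (T : Subring K) (hT : T ≤ O.toSubring), A.toSubring ≤ T → (subringCentre T O hT).IsMaximal) →
    ∀ g₀ : K, (∀ c : K, c ^ p ≠ g₀) →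
    (∀ f₀ : K, ∃ f₁ : K, O.valuation (g₀ - f₁ ^ p) < O.valuation (g₀ - f₀ ^ p)) →
    (∀ hk : ∀ c : k, algebraMap k K c ∈ O, transcendenceDefect k O hk ≠ 0) →
    ¬ (∃ π : K, π ≠ 0 ∧ (∀ x : K, O.valuation x < 1 → O.valuation x ≤ O.valuation π) ∧
      (∀ x : K, x ≠ 0 → ∃ n : ℕ, O.valuation π ^ n ≤ O.valuation x)) →
    ∃ (A' : Subalgebra k K), A'.toSubring ≤ O.toSubring ∧ A ≤ A' ∧ A'.FG ∧
    ∃ (_ : IsRegularLocalRing (locAtCentre A'.toSubring O)) (c : Fin p → K), (∃ j : Fin p, (j : ℕ) ≠ 0 ∧ c j ≠ 0) ∧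
    ((∃ (d m : ℕ) (hmd : m ≤ d) (t : Fin d → ↥(locAtCentre A'.toSubring O)) (a : Fin m → ℕ) (u : ↥(locAtCentre A'.toSubring O)), IsUnit u ∧
    Ideal.span (Set.range t) = IsLocalRing.maximalIdeal ↥(locAtCentre A'.toSubring O) ∧
    ringKrullDim ↥(locAtCentre A'.toSubring O) = (d : WithBot ℕ∞) ∧ 0 < m ∧ (∀ i, ¬ p ∣ a i) ∧
    (∑ j : Fin p, c j ^ p * g₀ ^ (j : ℕ)) = (u : K) * ∏ i : Fin m, ((t (Fin.castLE hmd i) : ↥(locAtCentre A'.toSubring O)) : K) ^ (a i)) ∨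
    (∃ u : ↥(locAtCentre A'.toSubring O), IsUnit u ∧ (∑ j : Fin p, c j ^ p * g₀ ^ (j : ℕ)) = (u : K) ∧
    ∀ c' : ↥(locAtCentre A'.toSubring O), u - c' ^ p ∉ IsLocalRing.maximalIdeal ↥(locAtCentre A'.toSubring O)) ∨
    (∃ s c' : ↥(locAtCentre A'.toSubring O), (∑ j : Fin p, c j ^ p * g₀ ^ (j : ℕ)) = (s : K) ∧
    s - c' ^ p ∈ IsLocalRing.maximalIdeal ↥(locAtCentre A'.toSubring O) ∧
    s - c' ^ p ∉ IsLocalRing.maximalIdeal ↥(locAtCentre A'.toSubring O) ^ 2)) := by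
  intro hp k _ _ _ K _ _ O A hAO hAfg hfrac hdimA hreg hdim3 hzd g₀ hg₀ hdefect htd hndisc
  classical
  haveI : Fact p.Prime := ⟨hp⟩
  haveI := hfrac
  obtain ⟨b, hb0, hbA, hfA⟩ := exists_pow_mul_mem p hp A g₀
  set f : K := b ^ p * g₀ with hfdef
  have hf : ∀ c : K, c ^ p ≠ f := by
    intro c hc
    apply hg₀ (c / b)
    rw [div_pow, hc, hfdef, mul_comm, mul_div_cancel_right₀ _ (pow_ne_zero _ hb0)]
  obtain ⟨A', hA'O, hAA', hA'fg, hreg', hfS, hN'⟩ := hN ⟨hp⟩ k K O A hAO hAfg hfrac hdimA hreg hdim3 hzd f hfA hf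
  haveI : IsFractionRing A' K := isFractionRing_of_le' hAA'
  have hmax : (subringCentre A'.toSubring O hA'O).IsMaximal := hzd A'.toSubring hA'O (fun x hx => hAA' hx)
  haveI : IsRegularLocalRing ↥(locAtCentre A'.toSubring O) := hreg'
  exact concl_of_looseCleanRep (hreg' := hreg') hp O A A' hA'O hAA' hA'fg g₀ b hb0
    (hR ⟨hp⟩ k K O A' hA'O hA'fg inferInstance hmax hreg' f hfS hf hN')


/-! ## 7. The GLOBAL named-fact shape (scheme level; twin of the tree's `Giraud1983Thm24`)

For the registrar: Cossart's theorem as a statement about schemes, rendered exactly like `Literature.….Giraud1983Thm24` (dimension `2`,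
conclusion `Giraud15NormalFormAt` at every point) with dimension `3`, a finite-type structure morphism to an algebraically closed field, and
the LITERAL pointwise conclusion `NuZeroAt` (w.r.t. SOME snc germ through the point — weaker than «w.r.t. `E(n)`», and all the read-off needs).
`Cossart1987NuZeroAlongValuationAt p` = this ∘ the routine plumbing of §5's docstring (not proved here; the dimension-two plumbing of the
same shape is landed: ✓ `exists_fg_regular_of_hasResolution`, ✓ `RadicialJungCleanModelsCleanLU2Extraction`).
-/

open CategoryTheory AlgebraicGeometry TopologicalSpace in
/-- NAMED-FACT SHAPE, GLOBAL — **Cossart 1987** ([Cos87a] main theorem; [Posva2024] App. A §A.1 «`k` algebraically closed of characteristic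
`p > 0`, `X` a regular variety of dimension three over `k`, `f ∈ H⁰(X, 𝒪_X)` not a `p`-th power» and §A.1.3): `X` an integral quasi-compact
regular scheme of dimension `3`, separated and locally of finite type over an algebraically closed field `k` of characteristic `p` (= a regular
`k`-variety; rev 7 adds the `[IsSeparated sX]` binder and rev 9 the hypothesis `CP2008.IsQuasiProjectiveOver sX` — Posva §2.1 (a) «variety =
integral quasi-projective `k`-scheme of finite type», typed by the tree's verbatim idiom of CP 2008 Thm 2.1 — so that the Prop is
verbatim-or-weaker than the verified secondary text clause by clause); `f ∈ Γ(X, 𝒪_X)` not a `p`-th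
power in `K(X)`; conclusion: a proper `π : X' → X`, an isomorphism over a non-empty open (a finite sequence of blow-ups in regular centres),
`X'` integral and regular, such that `ν = 0` holds for the pull-back of `f` at EVERY point of `X'` (`NuZeroAt`, §5).
Users take `(h : Cossart1987Thm)`. [cite: Posva2024 arXiv:2405.05735, App. A §A.1.3; Cossart1987] -/
def Cossart1987Thm : Prop :=
  ∀ (p : ℕ) [Fact p.Prime] (k : Type) [Field k] [CharP k p] [IsAlgClosed k]
    (X : Scheme.{0}) [IsIntegral X] [CompactSpace X] (sX : X ⟶ Spec (CommRingCat.of k))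
    [LocallyOfFiniteType sX] [IsSeparated sX],
    Literature.AlgebraicGeometry.CossartPiltant200819.CP2008.IsQuasiProjectiveOver sX →
    Scheme.IsRegular X → topologicalKrullDim X = 3 →
    ∀ f : Γ(X, ⊤), (∀ c : X.functionField, c ^ p ≠ (X.presheaf.germ ⊤ (genericPoint X) trivial) f) →
    ∃ (X' : Scheme.{0}) (π : X' ⟶ X), IsProper π ∧ IsIntegral X' ∧ Scheme.IsRegular X' ∧
      (∃ U : X.Opens, (U : Set X).Nonempty ∧ IsIso (π ∣_ U)) ∧
      ∀ x' : X', NuZeroAt ((X'.presheaf.germ ⊤ x' trivial) (π.appTop f))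


/-! ## 8. LEMMA G split (tree idiom): the `p`-basis at the closed centre is LANDED machinery over ANY ground field;
the ring-level read-off `NuZeroReadOffOfPBasis` is the one prover target

* (G-pb) `exists_isPBasisOver_locAtCentre` — KERNEL (this file): at `S' = locAtCentre A' O` with `A'` a finitely generated
  `k`-subalgebra and MAXIMAL centre, every regular system of parameters `t` of `S'` is contained in a `p`-basis `Γ` of `S'`
  over `S'^p` — ✓ `exists_isPBasisOver_containing_rsop` (Kimura–Niitsuma 1980 Thm. 3.4 at a closed point, landed
  `Theorems/RadicialJungCleanModelsPBasisAtClosedPoint.lean`) with the plumbing of ✓ `exists_isPBasisOver_stalk` transcribed from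
  stalks to `locAtCentre` (`y/z = (y z^{p-1})·(1/z)^p`; Zariski's lemma for `A'/𝔮`).  No perfectness: `k` is ANY field of
  characteristic `p` (over a perfect `k`, `Γ = {t}` by the count `[K : K^p] = p^d`, memo §4; not needed).
* (G-alg) `NuZeroReadOffOfPBasis p` — OURS, ring level (memo §4 (i)–(iv) in the tree idiom): `O` regular local of
  characteristic `p`, `K = Frac O`, `Γ ⊇ {t}` a `p`-basis over `O^p`, `f ∉ K^p`, `𝒥(f, E) = (∏ tᵢ^{bᵢ})` ⇒ the three forms.
  Engine for step (i): ✓ `term_mem_of_mul_derivation_sum_mem` (`RadicialJungCleanModelsPBasisMonomialIdeal.lean`: an ideal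
  stable under the `γ δ_γ` contains every monomial term of its elements' images) with ✓ `IsPBasisOver.exists_monomialBasis`,
  ✓ `IsPBasisOver.exists_dual_derivations`, ✓ `derivation_apply_eq_sum_mul_dual`; steps (ii)–(iv) elementary (memo §4 add. 2:
  the residue field need NOT be perfect — a unit `δ_γ g` for a residual coordinate `γ` forces `ḡ ∉ κ^p`, i.e. form (2)).
* Glue `nuZeroReadOff_of_pBasis : NuZeroReadOffOfPBasis p → NuZeroReadOffAlongValuationAt p`, the latter now stated for EVERY
  field `k` of characteristic `p`.
-/

/-- (G-pb) KERNEL — **a `p`-basis of `locAtCentre A' O` over its `p`-th powers containing a prescribed regular system of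
parameters**, for `A'` a finitely generated `k`-subalgebra of `K` dominated by `O` with MAXIMAL centre, `k` any field of
characteristic `p` (Kimura–Niitsuma 1980, Thm. 3.4 at a closed point: ✓ `exists_isPBasisOver_containing_rsop`; plumbing as in
✓ `exists_isPBasisOver_stalk`). [cite: KimuraNiitsuma1980, Thm. 3.4] -/
theorem exists_isPBasisOver_locAtCentre (p : ℕ) [Fact p.Prime] (k : Type) [Field k] [CharP k p] (K : Type) [Field K]
    [Algebra k K] (O : ValuationSubring K) (A' : Subalgebra k K) (hA'O : A'.toSubring ≤ O.toSubring) (hA'fg : A'.FG)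
    (hmax : (subringCentre A'.toSubring O hA'O).IsMaximal) [IsRegularLocalRing ↥(locAtCentre A'.toSubring O)]
    [CharP ↥(locAtCentre A'.toSubring O) p] {d : ℕ} (t : Fin d → ↥(locAtCentre A'.toSubring O))
    (ht : Ideal.span (Set.range t) = maximalIdeal ↥(locAtCentre A'.toSubring O))
    (hd : ringKrullDim ↥(locAtCentre A'.toSubring O) = (d : WithBot ℕ∞)) :
    ∃ Γ : Set ↥(locAtCentre A'.toSubring O), Set.range t ⊆ Γ ∧
      IsPBasisOver p (frobenius ↥(locAtCentre A'.toSubring O) p).range Γ := by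
  classical
  have hp : p.Prime := Fact.out
  obtain ⟨t₀, ht₀⟩ := hA'fg
  have hsub : ∀ x ∈ t₀, x ∈ A' := fun x hx => by
    rw [← ht₀]; exact Algebra.subset_adjoin (Finset.mem_coe.mpr hx)
  -- the base `B = A'` as a subring of `K`, a finitely generated `k`-algebra
  let ψ : k →+* ↥A'.toSubring := (algebraMap k K).codRestrict A'.toSubring fun c => A'.algebraMap_mem c
  letI : Algebra k ↥A'.toSubring := ψ.toAlgebra
  let emb : {x // x ∈ t₀} → ↥A'.toSubring := fun x => ⟨x.1, hsub x.1 x.2⟩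
  have hft : Algebra.adjoin k (↑(t₀.attach.image emb) : Set ↥A'.toSubring) = ⊤ := by
    let val : ↥A'.toSubring →ₐ[k] K :=
      { A'.toSubring.subtype with commutes' := fun c => rfl }
    have hval : Function.Injective val := Subtype.val_injective
    have himg : (val '' (↑(t₀.attach.image emb) : Set ↥A'.toSubring)) = (↑t₀ : Set K) := by
      ext x
      constructor
      · rintro ⟨y, hy, rfl⟩
        obtain ⟨a, -, rfl⟩ := Finset.mem_image.mp (Finset.mem_coe.mp hy)
        exact Finset.mem_coe.mpr a.2
      · intro hx
        exact ⟨emb ⟨x, Finset.mem_coe.mp hx⟩, Finset.mem_coe.mpr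
          (Finset.mem_image_of_mem _ (Finset.mem_attach _ _)), rfl⟩
    rw [eq_top_iff]
    rintro b -
    have hb : (b : K) ∈ Algebra.adjoin k (↑t₀ : Set K) := by rw [ht₀]; exact b.2
    rw [← himg, ← AlgHom.map_adjoin] at hb
    obtain ⟨b', hb', hbb'⟩ := hb
    have hb'b : b' = b := hval hbb'
    rw [← hb'b]; exact hb'
  haveI hftI : Algebra.FiniteType k ↥A'.toSubring := ⟨⟨t₀.attach.image emb, hft⟩⟩
  -- `S' = locAtCentre A' O` as the localisation of `B` at the maximal ideal `𝔮`
  haveI := isLocalization_locAtCentre hA'O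
  let φ : k →+* ↥(locAtCentre A'.toSubring O) := (algebraMap ↥A'.toSubring ↥(locAtCentre A'.toSubring O)).comp ψ
  letI : Algebra k ↥(locAtCentre A'.toSubring O) := φ.toAlgebra
  have hφ : ∀ c : k, algebraMap k ↥(locAtCentre A'.toSubring O) c =
      algebraMap ↥A'.toSubring ↥(locAtCentre A'.toSubring O) (algebraMap k ↥A'.toSubring c) := fun _ => rfl
  -- (hgen) ring generation by `p`-th powers, `k` and the algebra generators
  have hgen : ∃ s : Finset ↥(locAtCentre A'.toSubring O), Subring.closure
      (Set.range (frobenius ↥(locAtCentre A'.toSubring O) p) ∪ Set.range (algebraMap k ↥(locAtCentre A'.toSubring O)) ∪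
        ↑s) = ⊤ := by
    refine ⟨(t₀.attach.image emb).image (algebraMap ↥A'.toSubring ↥(locAtCentre A'.toSubring O)), ?_⟩
    set C := Subring.closure
      (Set.range (frobenius ↥(locAtCentre A'.toSubring O) p) ∪ Set.range (algebraMap k ↥(locAtCentre A'.toSubring O)) ∪
        ↑((t₀.attach.image emb).image (algebraMap ↥A'.toSubring ↥(locAtCentre A'.toSubring O)))) with hC
    have hA : ∀ a : ↥A'.toSubring, algebraMap ↥A'.toSubring ↥(locAtCentre A'.toSubring O) a ∈ C := by
      intro a
      have ha : a ∈ (Algebra.adjoin k (↑(t₀.attach.image emb) : Set ↥A'.toSubring)).toSubring := by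
        rw [hft, Algebra.top_toSubring]; exact Subring.mem_top a
      rw [Algebra.adjoin_eq_ring_closure] at ha
      have ha' : algebraMap ↥A'.toSubring ↥(locAtCentre A'.toSubring O) a ∈
          (Subring.closure (Set.range (algebraMap k ↥A'.toSubring) ∪ ↑(t₀.attach.image emb))).map
            (algebraMap ↥A'.toSubring ↥(locAtCentre A'.toSubring O)) := ⟨a, ha, rfl⟩
      rw [RingHom.map_closure] at ha'
      refine (Subring.closure_le.mpr ?_) ha'
      rintro _ ⟨a', ha'', rfl⟩
      rcases ha'' with ⟨c, rfl⟩ | ha''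
      · exact Subring.subset_closure (Or.inl (Or.inr ⟨c, hφ c⟩))
      · exact Subring.subset_closure (Or.inr (Finset.mem_coe.mpr (Finset.mem_image_of_mem _ ha'')))
    have hCpow : ∀ r : ↥(locAtCentre A'.toSubring O), r ^ p ∈ C := fun r =>
      Subring.subset_closure (Or.inl (Or.inl ⟨r, frobenius_def _ _⟩))
    rw [eq_top_iff]
    rintro z -
    obtain ⟨a, b, rfl⟩ := IsLocalization.exists_mk'_eq (subringCentre A'.toSubring O hA'O).primeCompl z
    obtain ⟨u, hu⟩ := IsLocalization.map_units ↥(locAtCentre A'.toSubring O) b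
    have hz : IsLocalization.mk' ↥(locAtCentre A'.toSubring O) a b =
        algebraMap ↥A'.toSubring ↥(locAtCentre A'.toSubring O) a *
          ((u⁻¹ : (↥(locAtCentre A'.toSubring O))ˣ) : ↥(locAtCentre A'.toSubring O)) := by
      rw [Units.eq_mul_inv_iff_mul_eq, hu]
      exact IsLocalization.mk'_spec _ a b
    rw [hz]
    refine C.mul_mem (hA a) (units_inv_mem_subring_of_pow_mem hp.one_lt.le C hCpow u ?_)
    rw [hu]; exact hA _
  -- (hfin) the residue field is finite over `k` (Zariski's lemma for `A'/𝔮`)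
  have hfin : ∃ (n : ℕ) (e : Fin n → ResidueField ↥(locAtCentre A'.toSubring O)), ∀ z, ∃ c : Fin n → k,
      z = ∑ i, residue ↥(locAtCentre A'.toSubring O) (algebraMap k ↥(locAtCentre A'.toSubring O) (c i)) * e i := by
    let 𝔮 := subringCentre A'.toSubring O hA'O
    haveI : 𝔮.IsMaximal := hmax
    letI : Field (↥A'.toSubring ⧸ 𝔮) := Ideal.Quotient.field 𝔮
    haveI : Algebra.FiniteType k (↥A'.toSubring ⧸ 𝔮) := inferInstance
    haveI : Module.Finite k (↥A'.toSubring ⧸ 𝔮) := finite_of_finite_type_of_isJacobsonRing k _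
    obtain ⟨n, e₀, he₀⟩ := Module.Finite.exists_fin (R := k) (M := ↥A'.toSubring ⧸ 𝔮)
    let E := IsLocalization.AtPrime.equivQuotMaximalIdeal 𝔮 ↥(locAtCentre A'.toSubring O)
    have hE : ∀ c : k, E (algebraMap k (↥A'.toSubring ⧸ 𝔮) c) =
        residue ↥(locAtCentre A'.toSubring O) (algebraMap k ↥(locAtCentre A'.toSubring O) c) := by
      intro c
      rw [← Ideal.Quotient.mk_algebraMap, IsLocalization.AtPrime.equivQuotMaximalIdeal_apply_mk, hφ]
      rfl
    refine ⟨n, fun i => E (e₀ i), fun z => ?_⟩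
    obtain ⟨c, hc⟩ := (Submodule.mem_span_range_iff_exists_fun k).mp
      (show E.symm z ∈ Submodule.span k (Set.range e₀) by rw [he₀]; exact Submodule.mem_top)
    refine ⟨c, ?_⟩
    have hz : z = E (E.symm z) := (E.apply_symm_apply z).symm
    rw [hz, ← hc, map_sum]
    refine Finset.sum_congr rfl fun i _ => ?_
    rw [Algebra.smul_def, map_mul, hE]
    rfl
  exact exists_isPBasisOver_containing_rsop p hgen hfin t ht hd

/-- (G-alg) SUPPORT (OURS; memo §4 LEMMA G (i)–(iv), ring level, tree idiom) — `O` regular local of characteristic `p` with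
fraction field `K`, `Γ` a `p`-basis of `O` over `O^p` containing the regular system of parameters `t` (`d = dim O`); `f ∈ O`
not a `p`-th power in `K`; `ν = 0` for `(f, E)`, `E` = the first `e` coordinate hyperplanes, with multiplicities `b`: then the
`K^p`-line of `f` has a loosely clean two-term representative `c₀^p + c₁^p f`, `c₁ ≠ 0` (forms (1)/(2)/(3), conclusion shape of
✓ `stub_looseCleanOfGiraud15`).  No perfectness hypothesis.  [folklore] -/
def NuZeroReadOffOfPBasis (p : ℕ) : Prop :=
  ∀ (_ : Fact p.Prime) (O : Type) [CommRing O] [IsRegularLocalRing O] [CharP O p] (K : Type) [Field K] [Algebra O K]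
    [IsFractionRing O K] (Γ : Set O), IsPBasisOver p (frobenius O p).range Γ →
    ∀ (d e : ℕ) (hed : e ≤ d) (t : Fin d → O) (b : Fin e → ℕ),
    Ideal.span (Set.range t) = maximalIdeal O → ringKrullDim O = (d : WithBot ℕ∞) → Set.range t ⊆ Γ →
    ∀ f : O, (∀ c : K, c ^ p ≠ algebraMap O K f) →
    Ideal.span {v : O | ∃ D : Derivation ℤ O O,
        (∀ i : Fin e, t (Fin.castLE hed i) ∣ D (t (Fin.castLE hed i))) ∧ D f = v} =
      Ideal.span {∏ i : Fin e, t (Fin.castLE hed i) ^ b i} →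
    ∃ c₀ c₁ : K, c₁ ≠ 0 ∧
    ((∃ (d' m : ℕ) (hmd : m ≤ d') (t' : Fin d' → O) (a' : Fin m → ℕ) (w : O), IsUnit w ∧
        Ideal.span (Set.range t') = maximalIdeal O ∧ ringKrullDim O = (d' : WithBot ℕ∞) ∧ 0 < m ∧ (∀ i, ¬ p ∣ a' i) ∧
        c₀ ^ p + c₁ ^ p * algebraMap O K f = algebraMap O K (w * ∏ i : Fin m, t' (Fin.castLE hmd i) ^ (a' i))) ∨
     (∃ w : O, IsUnit w ∧ c₀ ^ p + c₁ ^ p * algebraMap O K f = algebraMap O K w ∧ ∀ c : O, w - c ^ p ∉ maximalIdeal O) ∨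
     (∃ s c : O, c₀ ^ p + c₁ ^ p * algebraMap O K f = algebraMap O K s ∧ s - c ^ p ∈ maximalIdeal O ∧
        s - c ^ p ∉ maximalIdeal O ^ 2))

/-- KERNEL GLUE: (G-alg) ⇒ the along-`v` read-off `NuZeroReadOffAlongValuationAt` of §5 (for every field `k`), the `p`-basis
being supplied by `exists_isPBasisOver_locAtCentre`. [folklore] -/
theorem nuZeroReadOff_of_pBasis (p : ℕ) (h2 : NuZeroReadOffOfPBasis p) : NuZeroReadOffAlongValuationAt p := by
  intro hp k _ _ K _ _ O A' hA'O hA'fg hfrac hmax hreg f hfS hf hN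
  classical
  haveI : Fact p.Prime := hp
  haveI : CharP K p := charP_of_injective_algebraMap (algebraMap k K).injective p
  haveI : IsRegularLocalRing ↥(locAtCentre A'.toSubring O) := hreg
  haveI := hfrac
  haveI : IsFractionRing ↥(locAtCentre A'.toSubring O) K := isFractionRing_locAtCentre (le_refl A') O
  obtain ⟨d, e, hed, t, b, ht, hd, hJ⟩ := hN
  obtain ⟨Γ, htΓ, hΓ⟩ := exists_isPBasisOver_locAtCentre p k K O A' hA'O hA'fg hmax t ht hd
  have hf' : ∀ c : K, c ^ p ≠ algebraMap (↥(locAtCentre A'.toSubring O)) K ⟨f, hfS⟩ := hf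
  obtain ⟨c₀, c₁, hc₁, hforms⟩ :=
    h2 hp (↥(locAtCentre A'.toSubring O)) K Γ hΓ d e hed t b ht hd htΓ ⟨f, hfS⟩ hf' hJ
  have hfK : algebraMap (↥(locAtCentre A'.toSubring O)) K ⟨f, hfS⟩ = f := rfl
  rw [hfK] at hforms
  refine ⟨c₀, c₁, hc₁, ?_⟩
  rcases hforms with ⟨d', m, hmd, t', a', w, hw, ht', hd', hm, ha', heq⟩ | ⟨w, hw, heq, hres⟩ | ⟨s, c', heq, hm1, hm2⟩
  · refine Or.inl ⟨d', m, hmd, t', a', w, hw, ht', hd', hm, ha', ?_⟩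
    rw [heq, map_mul, map_prod]
    simp_rw [map_pow]
    rfl
  · exact Or.inr (Or.inl ⟨w, hw, heq, hres⟩)
  · exact Or.inr (Or.inr ⟨s, c', heq, hm1, hm2⟩)


/-! ## 9. (G-alg) IN KERNEL — LEMMA G is PROVED: the read-off of `ν = 0` along a `p`-basis (rev 5)

The ring-level read-off `NuZeroReadOffOfPBasis p` of §8 is proved below (`ReadOff.readOff_core`, ≈ 330 lines of commutative algebra on
the landed `p`-basis engine: ✓ `IsPBasisOver.exists_monomial_expansion`, ✓ `IsPBasisOver.exists_dual_derivations`,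
✓ `derivation_apply_eq_sum_mul_dual`, ✓ `term_mem_of_mul_derivation_sum_mem`, ✓ `AbsolutePBasis.not_mem_sq_of_span_eq`).  Proof
(memo §4): (i) the diagonal operators `γ δ_γ` (`γ ∈ Γ`) are logarithmic along `x` and stabilise `I = (∏ xᵢ^{bᵢ})`, so every term of
nonzero class of the expansion `f = Σ c_β Γ^β` lies in `I` (no cancellation between monomial classes) and `f - F^p = M g`,
`M = ∏ xᵢ^{bᵢ}`; (ii) for a logarithmic `D`, `D f = M · (Σ wᵢ (bᵢ g + xᵢ δᵢ g) + D′ g)` with `D′ = D - Σ wᵢ xᵢ δᵢ` killing the `xᵢ`,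
so `M ∈ 𝒥 ⊆ M · J′`, `J′ := (bᵢ g + xᵢ δᵢ g, δ_γ g (γ ∉ x))`, and domain cancellation gives `J′ = (1)`: some generator is a unit;
(iii) cases: `g` unit and some `p ∤ bᵢ` ⇒ form (1) with `u = g` (parameters reordered, exponents `bᵢ mod p`); `g` unit and all
`p ∣ bᵢ` ⇒ a `δ_γ g` (`γ ∉ x`) is a unit ⇒ form (2), or form (3) because a derivation maps `𝔪²` into `𝔪`; `g ∈ 𝔪` ⇒ `δ_γ g` unit
forces `γ = t_l` (`l > e`; a `δ_γ` with `γ ∉ t` maps `𝔪` into `𝔪`) and the EXCHANGE `t_l ↦ g` is again a regular system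
(`span_range_update_eq`) ⇒ form (1) with the extra parameter `g` to the exponent `1`.  Consequences (kernel, this section's end):
`nuZeroReadOffOfPBasis_holds`, `nuZeroReadOffAlongValuationAt_holds` (LEMMA G along `v`, EVERY field `k`),
`cleanLU3Defect_algClosed_of_cossart1987NuZero` — THE `k̄`-SLICE OF :219 (every `p`, every class) MODULO THE LITERAL PRINT FACT
`Cossart1987NuZeroAlongValuationAt p` ALONE — and `cleanLU3Defect_perfect_of_equivariantCossartNuZero` — the perfect-field slice
modulo the research Prop F-eq alone.  [OURS · CANDIDATE] counted 0; resolution in char `p` NOT proved. -/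

namespace ReadOff

/-! ### A. Generalities on derivations -/

section Deriv

variable {O : Type} [CommRing O]

omit [CommRing O] in
theorem natCast_mul_pow_pred_mul [CommRing O] (n : ℕ) (x w : O) :
    (n : O) * (x ^ (n - 1) * (x * w)) = (n : O) * x ^ n * w := by
  rcases n with _ | k
  · simp
  · rw [Nat.add_sub_cancel, ← mul_assoc (x ^ k), ← pow_succ, mul_assoc]

/-- Logarithmic derivative of a product of powers: if `D xᵢ = xᵢ wᵢ` on `s` then
`D (∏_{i∈s} xᵢ^{bᵢ}) = (∏_{i∈s} xᵢ^{bᵢ}) · Σ_{i∈s} bᵢ wᵢ`. [folklore] -/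
theorem derivation_prod_pow_of_log {ι : Type*} (s : Finset ι) (D : Derivation ℤ O O) (x w : ι → O)
    (b : ι → ℕ) (h : ∀ i ∈ s, D (x i) = x i * w i) :
    D (∏ i ∈ s, x i ^ b i) = (∏ i ∈ s, x i ^ b i) * ∑ i ∈ s, (b i : O) * w i := by
  classical
  induction s using Finset.induction_on with
  | empty => simp
  | insert a s ha ih =>
    rw [Finset.prod_insert ha, Finset.sum_insert ha, D.leibniz,
      ih (fun j hj => h j (Finset.mem_insert_of_mem hj)), D.leibniz_pow,
      h a (Finset.mem_insert_self a s), smul_eq_mul, smul_eq_mul, smul_eq_mul, nsmul_eq_mul,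
      natCast_mul_pow_pred_mul]
    ring

/-- A derivation maps `I²` into `I`. [folklore] -/
theorem derivation_apply_mem_of_mem_sq (I : Ideal O) (D : Derivation ℤ O O) {v : O} (hv : v ∈ I ^ 2) :
    D v ∈ I := by
  rw [pow_two] at hv
  refine Submodule.mul_induction_on hv ?_ ?_
  · intro a ha c hc
    rw [D.leibniz, smul_eq_mul, smul_eq_mul]
    exact I.add_mem (I.mul_mem_right _ ha) (I.mul_mem_right _ hc)
  · intro x y hx hy
    rw [map_add]
    exact I.add_mem hx hy

/-- Evaluation of a finite sum of scaled derivations (indexed by an arbitrary finite type). [folklore] -/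
theorem sum_smul_derivation_apply' {ι : Type*} (s : Finset ι) (a : ι → O) (δ : ι → Derivation ℤ O O)
    (r : O) : (∑ i ∈ s, a i • δ i) r = ∑ i ∈ s, a i * δ i r := by
  rw [← Derivation.coeFnAddMonoidHom_apply, map_sum, Finset.sum_apply]
  refine Finset.sum_congr rfl fun i _ => ?_
  rw [Derivation.coeFnAddMonoidHom_apply, Derivation.smul_apply, smul_eq_mul]

end Deriv

/-! ### B. Regular systems of parameters: injectivity, reordering, exchange -/

section Rsop

variable {O : Type} [CommRing O]

/-- A family of `d = dim O` generators of the maximal ideal of a regular local ring is injective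
(a minimal system of generators). [cite: Matsumura1987, §14 p. 121] -/
theorem rsop_injective [IsRegularLocalRing O] {d : ℕ} (hd : ringKrullDim O = (d : WithBot ℕ∞))
    {t : Fin d → O} (ht : Ideal.span (Set.range t) = maximalIdeal O) : Function.Injective t := by
  classical
  intro i j hij
  by_contra hne
  have hsf : (maximalIdeal O).spanFinrank = d := by
    have h := IsRegularLocalRing.spanFinrank_maximalIdeal (R := O)
    rw [hd] at h
    exact_mod_cast h
  set S : Finset O := (Finset.univ.erase i).image t with hS
  have heq : Ideal.span (S : Set O) = maximalIdeal O := by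
    rw [← ht]
    apply le_antisymm
    · apply Ideal.span_mono
      intro x hx
      obtain ⟨l, -, rfl⟩ := Finset.mem_image.mp (Finset.mem_coe.mp hx)
      exact ⟨l, rfl⟩
    · rw [Ideal.span_le]
      rintro _ ⟨l, rfl⟩
      by_cases hl : l = i
      · subst hl
        rw [hij]
        exact Ideal.subset_span (Finset.mem_coe.mpr (Finset.mem_image.mpr
          ⟨j, Finset.mem_erase.mpr ⟨Ne.symm hne, Finset.mem_univ _⟩, rfl⟩))
      · exact Ideal.subset_span (Finset.mem_coe.mpr (Finset.mem_image.mpr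
          ⟨l, Finset.mem_erase.mpr ⟨hl, Finset.mem_univ _⟩, rfl⟩))
  have h1 : (maximalIdeal O).spanFinrank ≤ S.card := by
    rw [← heq, ← Set.ncard_coe_finset]
    exact Submodule.spanFinrank_span_le_ncard_of_finite S.finite_toSet
  have h2 : S.card ≤ d - 1 := by
    calc S.card ≤ (Finset.univ.erase i).card := Finset.card_image_le
      _ = d - 1 := by rw [Finset.card_erase_of_mem (Finset.mem_univ i), Finset.card_univ, Fintype.card_fin]
  have h3 : 0 < d := Fin.pos i
  omega

/-- No member of such a family vanishes. [cite: Matsumura1987, §14 p. 121] -/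
theorem rsop_ne_zero [IsRegularLocalRing O] {d : ℕ} (hd : ringKrullDim O = (d : WithBot ℕ∞))
    {t : Fin d → O} (ht : Ideal.span (Set.range t) = maximalIdeal O) (i : Fin d) : t i ≠ 0 := by
  intro h
  have := AbsolutePBasis.not_mem_sq_of_span_eq hd ht i
  rw [h] at this
  exact this (Ideal.zero_mem _)

/-- Extension by zero of an exponent vector on the first `e` indices. -/
theorem prod_pow_extend {d e : ℕ} (hed : e ≤ d) (τ : Fin d → O) (r : Fin e → ℕ) :
    ∏ l : Fin d, τ l ^ (if h : (l : ℕ) < e then r ⟨l, h⟩ else 0) =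
      ∏ i : Fin e, τ (Fin.castLE hed i) ^ r i := by
  classical
  have hinj : Function.Injective (Fin.castLE hed) := Fin.castLE_injective hed
  rw [← Finset.prod_subset (Finset.subset_univ (Finset.univ.image (Fin.castLE hed))),
    Finset.prod_image (fun i _ j _ h => hinj h)]
  · refine Finset.prod_congr rfl fun i _ => ?_
    rw [dif_pos (show ((Fin.castLE hed i : Fin d) : ℕ) < e from i.2)]
    rfl
  · intro l _ hl
    rw [dif_neg, pow_zero]
    intro h
    exact hl (Finset.mem_image.mpr ⟨⟨l, h⟩, Finset.mem_univ _, Fin.ext rfl⟩)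

/-- **Reordering.** Given `τ : Fin d → O` and exponents `ρ : Fin d → ℕ`, the family can be reordered so that
the indices with nonzero exponent come first: `∏ τ_l^{ρ_l} = ∏_{j<m} t'_j^{a'_j}` with `t'` a rearrangement of
`τ` (same range), `m = #{ρ ≠ 0}` and every `a'_j` a nonzero value of `ρ`. [folklore] -/
theorem exists_reorder {d : ℕ} (τ : Fin d → O) (ρ : Fin d → ℕ) :
    ∃ (m : ℕ) (hmd : m ≤ d) (t' : Fin d → O) (a' : Fin m → ℕ),
      Set.range t' = Set.range τ ∧ ((∃ l, ρ l ≠ 0) → 0 < m) ∧ (∀ j, ∃ l, ρ l ≠ 0 ∧ a' j = ρ l) ∧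
      ∏ l, τ l ^ ρ l = ∏ j : Fin m, t' (Fin.castLE hmd j) ^ a' j := by
  classical
  let S : Finset (Fin d) := Finset.univ.filter fun l => ρ l ≠ 0
  let T : Finset (Fin d) := Finset.univ.filter fun l => ¬ (ρ l ≠ 0)
  have hmn : S.card + T.card = d := by
    simp only [S, T]
    rw [Finset.card_filter_add_card_filter_not, Finset.card_univ, Fintype.card_fin]
  let σS : Fin S.card ↪o Fin d := S.orderEmbOfFin rfl
  let σT : Fin T.card ↪o Fin d := T.orderEmbOfFin rfl
  let u : Fin S.card → O := fun j => τ (σS j)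
  let v : Fin T.card → O := fun j => τ (σT j)
  let t' : Fin d → O := fun l => Fin.append u v (Fin.cast hmn.symm l)
  have hmd : S.card ≤ d := by omega
  have ht'cast : ∀ j : Fin S.card, t' (Fin.castLE hmd j) = τ (σS j) := by
    intro j
    show Fin.append u v (Fin.cast hmn.symm (Fin.castLE hmd j)) = τ (σS j)
    rw [show Fin.cast hmn.symm (Fin.castLE hmd j) = Fin.castAdd T.card j from Fin.ext rfl, Fin.append_left]
  refine ⟨S.card, hmd, t', fun j => ρ (σS j), ?_, ?_, ?_, ?_⟩
  · -- same range
    apply le_antisymm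
    · rintro _ ⟨l, rfl⟩
      show Fin.append u v (Fin.cast hmn.symm l) ∈ Set.range τ
      generalize Fin.cast hmn.symm l = i
      induction i using Fin.addCases with
      | left j => rw [Fin.append_left]; exact ⟨σS j, rfl⟩
      | right j => rw [Fin.append_right]; exact ⟨σT j, rfl⟩
    · rintro _ ⟨l, rfl⟩
      by_cases hl : ρ l ≠ 0
      · have hlS : l ∈ Set.range σS := by
          rw [Finset.range_orderEmbOfFin]; exact Finset.mem_coe.mpr (Finset.mem_filter.mpr ⟨Finset.mem_univ _, hl⟩)
        obtain ⟨j, hj⟩ := hlS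
        refine ⟨Fin.cast hmn (Fin.castAdd T.card j), ?_⟩
        show Fin.append u v (Fin.cast hmn.symm (Fin.cast hmn (Fin.castAdd T.card j))) = τ l
        rw [show Fin.cast hmn.symm (Fin.cast hmn (Fin.castAdd T.card j)) = Fin.castAdd T.card j from Fin.ext rfl,
          Fin.append_left, ← hj]
      · have hlT : l ∈ Set.range σT := by
          rw [Finset.range_orderEmbOfFin]; exact Finset.mem_coe.mpr (Finset.mem_filter.mpr ⟨Finset.mem_univ _, hl⟩)
        obtain ⟨j, hj⟩ := hlT
        refine ⟨Fin.cast hmn (Fin.natAdd S.card j), ?_⟩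
        show Fin.append u v (Fin.cast hmn.symm (Fin.cast hmn (Fin.natAdd S.card j))) = τ l
        rw [show Fin.cast hmn.symm (Fin.cast hmn (Fin.natAdd S.card j)) = Fin.natAdd S.card j from Fin.ext rfl,
          Fin.append_right, ← hj]
  · rintro ⟨l, hl⟩
    exact Finset.card_pos.mpr ⟨l, Finset.mem_filter.mpr ⟨Finset.mem_univ _, hl⟩⟩
  · intro j
    exact ⟨σS j, (Finset.mem_filter.mp (Finset.orderEmbOfFin_mem S rfl j)).2, rfl⟩
  · -- the product
    have h1 : ∏ j : Fin S.card, t' (Fin.castLE hmd j) ^ ρ (σS j) = ∏ l ∈ S, τ l ^ ρ l := by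
      rw [← Finset.prod_coe_sort S (fun l => τ l ^ ρ l)]
      refine Fintype.prod_equiv (S.orderIsoOfFin rfl).toEquiv _ _ fun j => ?_
      rw [ht'cast j]
      simp only [RelIso.coe_fn_toEquiv, Finset.coe_orderIsoOfFin_apply]
      rfl
    rw [h1]
    symm
    exact Finset.prod_filter_of_ne fun l _ hne h0 => hne (by rw [h0, pow_zero])

/-- **Exchange.** If `𝔪 = (t₁, …, t_d)`, `g ∈ 𝔪`, and a derivation `D` with `D t_l = 1`, `D t_{l'} = 0` (`l' ≠ l`)
has `D g` a unit, then replacing `t_l` by `g` still generates `𝔪`. [folklore] -/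
theorem span_range_update_eq [IsLocalRing O] {d : ℕ} (t : Fin d → O)
    (ht : Ideal.span (Set.range t) = maximalIdeal O) (l : Fin d) (g : O) (hg : g ∈ maximalIdeal O)
    (D : Derivation ℤ O O) (hDl : D (t l) = 1) (hD : ∀ l', l' ≠ l → D (t l') = 0) (hDg : IsUnit (D g)) :
    Ideal.span (Set.range (Function.update t l g)) = maximalIdeal O := by
  classical
  apply le_antisymm
  · rw [Ideal.span_le]
    rintro _ ⟨l', rfl⟩
    by_cases h : l' = l
    · subst h; rw [Function.update_self]; exact hg
    · rw [Function.update_of_ne h, SetLike.mem_coe, ← ht]; exact Ideal.subset_span ⟨l', rfl⟩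
  · conv_lhs => rw [← ht]
    rw [Ideal.span_le]
    rintro _ ⟨l', rfl⟩
    by_cases h : l' = l
    · subst h
      have hg' : g ∈ Ideal.span (Set.range t) := by rw [ht]; exact hg
      obtain ⟨a, ha⟩ := (Submodule.mem_span_range_iff_exists_fun O).mp hg'
      simp only [smul_eq_mul] at ha
      -- `D g = a l' + Σ t_i D(a_i)`
      have hDg' : D g = a l' + ∑ i, t i * D (a i) := by
        rw [← ha, map_sum]
        have : ∀ i, D (a i * t i) = a i * D (t i) + t i * D (a i) := fun i => by
          rw [D.leibniz, smul_eq_mul, smul_eq_mul]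
        simp_rw [this]
        rw [Finset.sum_add_distrib, Finset.sum_eq_single l' (fun i _ hi => by rw [hD i hi, mul_zero])
          (fun hn => (hn (Finset.mem_univ _)).elim), hDl, mul_one]
      have hal : IsUnit (a l') := by
        by_contra hnu
        have hmem : a l' ∈ maximalIdeal O := (IsLocalRing.mem_maximalIdeal _).mpr hnu
        have hsum : ∑ i, t i * D (a i) ∈ maximalIdeal O :=
          Ideal.sum_mem _ fun i _ => Ideal.mul_mem_right _ _ (by rw [← ht]; exact Ideal.subset_span ⟨i, rfl⟩)
        have : D g ∈ maximalIdeal O := by rw [hDg']; exact Ideal.add_mem _ hmem hsum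
        exact ((IsLocalRing.mem_maximalIdeal _).mp this) hDg
      obtain ⟨u, hu⟩ := hal
      have key : a l' * t l' = g - ∑ i ∈ Finset.univ.erase l', a i * t i := by
        rw [← ha, ← Finset.add_sum_erase _ _ (Finset.mem_univ l')]
        ring
      have htl : t l' = (↑u⁻¹ : O) * (g - ∑ i ∈ Finset.univ.erase l', a i * t i) := by
        rw [← key, ← hu, ← mul_assoc, Units.inv_mul, one_mul]
      rw [SetLike.mem_coe, htl]
      refine Ideal.mul_mem_left _ _ (Ideal.sub_mem _ ?_ (Ideal.sum_mem _ fun i hi => ?_))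
      · exact Ideal.subset_span ⟨l', Function.update_self ..⟩
      · refine Ideal.mul_mem_left _ _ (Ideal.subset_span ⟨i, ?_⟩)
        exact Function.update_of_ne (Finset.ne_of_mem_erase hi) g t
    · exact Ideal.subset_span ⟨l', Function.update_of_ne h g t⟩

end Rsop


/-! ### C. The read-off theorem (G-alg) -/

section Main

variable {p : ℕ} [hp : Fact p.Prime] {O : Type} [CommRing O] [IsRegularLocalRing O] [CharP O p]
  {K : Type} [Field K] [Algebra O K] [IsFractionRing O K]

/-- **(G-alg), core form.** See `NuZeroReadOffOfPBasis` in `Lens5_KbarCossartAnchor.lean` §8: for a regular local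
ring `O` of characteristic `p` with a `p`-basis `Γ ⊇ {t₁,…,t_d}` (`𝔪 = (t)`, `d = dim O`), an element `f ∉ K^p`
whose logarithmic Jacobian ideal along `x = (t₁,…,t_e)` is the monomial ideal `(∏ xᵢ^{bᵢ})` admits, after the
correction `c₀^p + c₁^p f`, one of Cossart–Piltant's three clean forms (1) / (2) / (3) (memo §4 (i)–(iv); engine: Giraud 1983,
2.6 (6) = ✓ `term_mem_of_mul_derivation_sum_mem`).  The hypothesis `f ∉ K^p` is not even used (it follows from `hJ`). [folklore] -/
theorem readOff_core {Γ : Set O} (hΓ : IsPBasisOver p (frobenius O p).range Γ) {d e : ℕ} (hed : e ≤ d)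
    (t : Fin d → O) (x : Fin e → O) (hxt : ∀ i, t (Fin.castLE hed i) = x i) (b : Fin e → ℕ)
    (ht : Ideal.span (Set.range t) = maximalIdeal O) (hd : ringKrullDim O = (d : WithBot ℕ∞))
    (htΓ : Set.range t ⊆ Γ) (f : O) (_hf : ∀ c : K, c ^ p ≠ algebraMap O K f)
    (hJ : Ideal.span {v : O | ∃ D : Derivation ℤ O O, (∀ i : Fin e, x i ∣ D (x i)) ∧ D f = v} =
      Ideal.span {∏ i : Fin e, x i ^ b i}) :
    ∃ c₀ c₁ : K, c₁ ≠ 0 ∧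
    ((∃ (d' m : ℕ) (hmd : m ≤ d') (t' : Fin d' → O) (a' : Fin m → ℕ) (w : O), IsUnit w ∧
        Ideal.span (Set.range t') = maximalIdeal O ∧ ringKrullDim O = (d' : WithBot ℕ∞) ∧ 0 < m ∧
        (∀ i, ¬ p ∣ a' i) ∧
        c₀ ^ p + c₁ ^ p * algebraMap O K f = algebraMap O K (w * ∏ i : Fin m, t' (Fin.castLE hmd i) ^ (a' i))) ∨
     (∃ w : O, IsUnit w ∧ c₀ ^ p + c₁ ^ p * algebraMap O K f = algebraMap O K w ∧
        ∀ c : O, w - c ^ p ∉ maximalIdeal O) ∨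
     (∃ s c : O, c₀ ^ p + c₁ ^ p * algebraMap O K f = algebraMap O K s ∧ s - c ^ p ∈ maximalIdeal O ∧
        s - c ^ p ∉ maximalIdeal O ^ 2)) := by
  classical
  have hp' : p.Prime := hp.out
  haveI : IsDomain O := isDomain_of_isRegularLocalRing O
  haveI : CharP K p := charP_of_injective_algebraMap (IsFractionRing.injective O K) p
  -- the parameters `x`
  have htinj : Function.Injective t := rsop_injective hd ht
  have hxinj : Function.Injective x := by
    intro i j h
    rw [← hxt, ← hxt] at h
    exact Fin.castLE_injective hed (htinj h)
  have hxΓ : ∀ i, x i ∈ Γ := fun i => hxt i ▸ htΓ ⟨_, rfl⟩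
  have hx𝔪 : ∀ i, x i ∈ maximalIdeal O := fun i => by
    rw [← hxt, ← ht]; exact Ideal.subset_span ⟨_, rfl⟩
  have hxne : ∀ i, x i ≠ 0 := fun i => hxt i ▸ rsop_ne_zero hd ht _
  let γx : Fin e → Γ := fun i => ⟨x i, hxΓ i⟩
  have hγxinj : Function.Injective γx := fun i j h => hxinj (congrArg Subtype.val h)
  have hγx_coe : ∀ i, ((γx i : Γ) : O) = x i := fun i => rfl
  obtain ⟨δ, hδ₁, hδ₀⟩ := IsPBasisOver.exists_dual_derivations hΓ
  -- the monomial `M = ∏ xᵢ^{bᵢ}` and the ideal `I = (M)`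
  set M : O := ∏ i, x i ^ b i with hMdef
  have hMne : M ≠ 0 := Finset.prod_ne_zero_iff.mpr fun i _ => pow_ne_zero _ (hxne i)
  set I : Ideal O := Ideal.span {M} with hIdef
  -- (A) the diagonal operators `γ δ_γ` are logarithmic along `x` and stabilise `I`
  have hdiag_log : ∀ γ : Γ, ∀ i, ((γ : O) • δ γ) (x i) = x i * (if γx i = γ then 1 else 0) := by
    intro γ i
    rw [Derivation.smul_apply, smul_eq_mul]
    split_ifs with h
    · rw [← h, hγx_coe, hδ₁, mul_one]
    · rw [← hγx_coe i, hδ₀ γ (γx i) h, mul_zero, mul_zero]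
  have hdiagM : ∀ γ : Γ, (γ : O) * δ γ M = M * ∑ i, (b i : O) * (if γx i = γ then 1 else 0) := by
    intro γ
    have := derivation_prod_pow_of_log Finset.univ ((γ : O) • δ γ) x (fun i => if γx i = γ then 1 else 0) b
      (fun i _ => hdiag_log γ i)
    rwa [Derivation.smul_apply, smul_eq_mul] at this
  have hIst : ∀ γ : Γ, ∀ v ∈ I, (γ : O) * δ γ v ∈ I := by
    intro γ v hv
    obtain ⟨a, rfl⟩ := Ideal.mem_span_singleton'.mp hv
    have : (γ : O) * δ γ (a * M) =
        (a * ∑ i, (b i : O) * (if γx i = γ then 1 else 0) + (γ : O) * δ γ a) * M := by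
      rw [(δ γ).leibniz, smul_eq_mul, smul_eq_mul, mul_add, ← mul_assoc, mul_comm (γ : O) a, mul_assoc,
        hdiagM γ]
      ring
    rw [this]
    exact Ideal.mul_mem_left _ _ (Ideal.mem_span_singleton_self M)
  -- (B) expansion of `f` along the `p`-basis; the terms of nonzero class lie in `I`
  obtain ⟨c, hc⟩ := IsPBasisOver.exists_monomial_expansion hΓ f
  have hsum : (∑ β ∈ c.support, (c β : O) * (β.1).prod (fun γ n => ((γ : Γ) : O) ^ n)) = f := hc
  have hL : ∀ D : Derivation ℤ O O, (∀ i, x i ∣ D (x i)) → D f ∈ I := by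
    intro D hD
    have hmem : D f ∈ Ideal.span {v : O | ∃ D : Derivation ℤ O O, (∀ i : Fin e, x i ∣ D (x i)) ∧ D f = v} :=
      Ideal.subset_span ⟨D, hD, rfl⟩
    rwa [hJ] at hmem
  have hTf : ∀ γ : Γ, (γ : O) * δ γ f ∈ I := by
    intro γ
    have := hL ((γ : O) • δ γ) (fun i => ⟨_, hdiag_log γ i⟩)
    rwa [Derivation.smul_apply, smul_eq_mul] at this
  have hterm : ∀ β ∈ c.support, β.1 ≠ 0 →
      (c β : O) * (β.1).prod (fun γ n => ((γ : Γ) : O) ^ n) ∈ I := by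
    intro β hβ hβ0
    obtain ⟨γ, hγ⟩ : ∃ γ, β.1 γ ≠ 0 := by
      by_contra h
      push Not at h
      exact hβ0 (Finsupp.ext h)
    refine term_mem_of_mul_derivation_sum_mem δ hδ₁ hδ₀ I hIst γ c.support (fun β => c β) ?_ β hβ hγ
    rw [hsum]
    exact hTf γ
  -- (C) `f - F^p ∈ I`
  let β0 : {b : Γ →₀ ℕ // ∀ γ, b γ < p} := ⟨0, fun _ => hp'.pos⟩
  obtain ⟨F, hF⟩ : ∃ F : O, (c β0 : O) = F ^ p := by
    obtain ⟨F, hF⟩ := RingHom.mem_range.mp (c β0).2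
    exact ⟨F, by rw [← hF, frobenius_def]⟩
  have hfF : f - F ^ p ∈ I := by
    rw [← hF]
    by_cases h0 : β0 ∈ c.support
    · rw [← hsum, ← Finset.add_sum_erase _ _ h0]
      have hmono0 : (β0.1).prod (fun γ n => ((γ : Γ) : O) ^ n) = 1 := Finsupp.prod_zero_index
      rw [hmono0, mul_one, add_sub_cancel_left]
      exact Ideal.sum_mem _ fun β hβ =>
        hterm β (Finset.mem_of_mem_erase hβ) (fun h => Finset.ne_of_mem_erase hβ (Subtype.ext h))
    · have hc0 : (c β0 : O) = 0 := by rw [Finsupp.notMem_support_iff.mp h0]; rfl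
      rw [hc0, sub_zero, ← hsum]
      refine Ideal.sum_mem _ fun β hβ => hterm β hβ (fun h => h0 ?_)
      have : β = β0 := Subtype.ext h
      rwa [this] at hβ
  obtain ⟨g, hg⟩ := Ideal.mem_span_singleton'.mp hfF
  have hfeq : f = F ^ p + g * M := sub_eq_iff_eq_add'.mp hg.symm
  -- (D) the ideal `J'` and the factorisation `𝒥 ⊆ (M) · J'`
  let gen : Fin e → O := fun i => (b i : O) * g + x i * δ (γx i) g
  let N : Set O := {v | ∃ γ : Γ, (∀ i, γx i ≠ γ) ∧ δ γ g = v}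
  let J' : Ideal O := Ideal.span (Set.range gen ∪ N)
  have hxδM : ∀ i, x i * δ (γx i) M = M * (b i : O) := by
    intro i
    rw [← hγx_coe i, hdiagM (γx i)]
    congr 1
    simp_rw [hγxinj.eq_iff, mul_boole]
    rw [Finset.sum_ite_eq']
    simp
  have hxδf : ∀ i, x i * δ (γx i) f = M * gen i := by
    intro i
    rw [hfeq, map_add, derivation_pow_char (p := p), zero_add, (δ (γx i)).leibniz, smul_eq_mul, smul_eq_mul,
      mul_add, ← mul_assoc, mul_comm (x i) g, mul_assoc, hxδM i]
    simp only [gen]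
    ring
  have hfact : ∀ D : Derivation ℤ O O, (∀ i, x i ∣ D (x i)) → D f ∈ I * J' := by
    intro D hD
    choose w hw using hD
    let D' : Derivation ℤ O O := D - ∑ i, (w i * x i) • δ (γx i)
    have hD'apply : ∀ r, D' r = D r - ∑ i, (w i * x i) * δ (γx i) r := by
      intro r
      simp only [D', Derivation.sub_apply, sum_smul_derivation_apply']
    have hD'x : ∀ j, D' (x j) = 0 := by
      intro j
      rw [hD'apply, hw j, Finset.sum_eq_single j (fun i _ hij => by
          rw [← hγx_coe j, hδ₀ (γx i) (γx j) (fun h => hij (hγxinj h).symm), mul_zero])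
        (fun hn => (hn (Finset.mem_univ _)).elim), ← hγx_coe j, hδ₁, mul_one, hγx_coe, mul_comm, sub_self]
    have hD'M : D' M = 0 := derivation_prod_pow_eq_zero D' x b Finset.univ (fun i _ => hD'x i)
    have hD'F : D' (F ^ p) = 0 := derivation_pow_char (p := p) D' F
    have hDf : D f = ∑ i, (w i * x i) * δ (γx i) f + D' f := by
      rw [hD'apply]; ring
    have hD'f : D' f = M * D' g := by
      rw [hfeq, map_add, hD'F, zero_add, D'.leibniz, hD'M, smul_eq_mul, smul_eq_mul, mul_zero, zero_add]
    have hD'g : D' g ∈ Ideal.span N := by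
      obtain ⟨Fg, hFg⟩ := derivation_apply_eq_sum_mul_dual δ hδ₁ hδ₀ hΓ g
      rw [hFg D']
      refine Ideal.sum_mem _ fun γ _ => ?_
      by_cases h : ∃ i, γx i = γ
      · obtain ⟨i, rfl⟩ := h
        rw [hγx_coe, hD'x i, zero_mul]
        exact Ideal.zero_mem _
      · push Not at h
        exact Ideal.mul_mem_left _ _ (Ideal.subset_span ⟨γ, h, rfl⟩)
    rw [hDf]
    refine Ideal.add_mem _ (Ideal.sum_mem _ fun i _ => ?_) ?_
    · rw [mul_assoc, hxδf i, ← mul_assoc, mul_comm (w i) M, mul_assoc]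
      exact Ideal.mul_mem_mul (Ideal.mem_span_singleton_self M)
        (Ideal.mul_mem_left _ _ (Ideal.subset_span (Or.inl ⟨i, rfl⟩)))
    · rw [hD'f]
      exact Ideal.mul_mem_mul (Ideal.mem_span_singleton_self M) (Ideal.span_mono Set.subset_union_right hD'g)
  -- hence `J' = ⊤`
  have hJ'top : J' = ⊤ := by
    have hMmem : M ∈ I * J' := by
      have hM : M ∈ Ideal.span {v : O | ∃ D : Derivation ℤ O O, (∀ i : Fin e, x i ∣ D (x i)) ∧ D f = v} := by
        rw [hJ]; exact Ideal.mem_span_singleton_self M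
      have hle : Ideal.span {v : O | ∃ D : Derivation ℤ O O, (∀ i : Fin e, x i ∣ D (x i)) ∧ D f = v} ≤ I * J' :=
        Ideal.span_le.mpr (by rintro _ ⟨D, hD, rfl⟩; exact hfact D hD)
      exact hle hM
    obtain ⟨z, hz, hMz⟩ := Ideal.mem_span_singleton_mul.mp hMmem
    have hz1 : z = 1 := mul_left_cancel₀ hMne (by rw [hMz, mul_one])
    rw [hz1] at hz
    exact (Ideal.eq_top_iff_one _).mpr hz
  -- some generator is a unit
  have hunit : (∃ i, IsUnit (gen i)) ∨ ∃ γ : Γ, (∀ i, γx i ≠ γ) ∧ IsUnit (δ γ g) := by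
    by_contra hcon
    push Not at hcon
    have hle : J' ≤ maximalIdeal O := by
      refine Ideal.span_le.mpr ?_
      rintro v (⟨i, rfl⟩ | ⟨γ, hγ, rfl⟩)
      · exact (IsLocalRing.mem_maximalIdeal _).mpr (hcon.1 i)
      · exact (IsLocalRing.mem_maximalIdeal _).mpr (hcon.2 γ hγ)
    rw [hJ'top, top_le_iff] at hle
    exact (IsLocalRing.maximalIdeal.isMaximal O).ne_top hle
  -- arithmetic in `K`: `c₁ = (∏ xᵢ^{⌊bᵢ/p⌋})⁻¹`, `c₀ = -c₁ F`
  let r : Fin e → ℕ := fun i => b i % p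
  let Q : O := ∏ i, x i ^ (b i / p)
  have hQne : Q ≠ 0 := Finset.prod_ne_zero_iff.mpr fun i _ => pow_ne_zero _ (hxne i)
  have hQK : algebraMap O K Q ≠ 0 := fun h =>
    hQne (IsFractionRing.injective O K (by rw [h, map_zero]))
  let c₁ : K := (algebraMap O K Q)⁻¹
  let c₀ : K := -(c₁ * algebraMap O K F)
  have hc₁ : c₁ ≠ 0 := inv_ne_zero hQK
  have hMQ : M = Q ^ p * ∏ i, x i ^ r i := by
    simp only [hMdef, Q, r]
    rw [← Finset.prod_pow, ← Finset.prod_mul_distrib]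
    refine Finset.prod_congr rfl fun i _ => ?_
    rw [← pow_mul, ← pow_add, Nat.div_add_mod']
  have hkey : c₀ ^ p + c₁ ^ p * algebraMap O K f = algebraMap O K (g * ∏ i, x i ^ r i) := by
    have hcQ : c₁ * algebraMap O K Q = 1 := inv_mul_cancel₀ hQK
    have h1 : c₀ ^ p = -(c₁ ^ p * algebraMap O K F ^ p) := by
      simp only [c₀]
      rw [neg_pow, neg_one_pow_char K p, mul_pow]
      ring
    rw [h1, hfeq, hMQ]
    simp only [map_add, map_mul, map_pow]
    calc -(c₁ ^ p * algebraMap O K F ^ p) + c₁ ^ p * (algebraMap O K F ^ p +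
          algebraMap O K g * ((algebraMap O K Q) ^ p * algebraMap O K (∏ i, x i ^ r i)))
        = (c₁ * algebraMap O K Q) ^ p * (algebraMap O K g * algebraMap O K (∏ i, x i ^ r i)) := by ring
      _ = algebraMap O K g * algebraMap O K (∏ i, x i ^ r i) := by rw [hcQ, one_pow, one_mul]
  have hrp : ∀ i, r i ≠ 0 → ¬ p ∣ r i := fun i hi hdvd =>
    hi (Nat.eq_zero_of_dvd_of_lt hdvd (Nat.mod_lt _ hp'.pos))
  refine ⟨c₀, c₁, hc₁, ?_⟩
  -- (E) the cases
  by_cases hgu : IsUnit g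
  · by_cases hr : ∃ i, r i ≠ 0
    · -- form (1): `g · ∏ xᵢ^{rᵢ}`, reordered
      left
      obtain ⟨i₀, hi₀⟩ := hr
      let ρ : Fin d → ℕ := fun l => if h : (l : ℕ) < e then r ⟨l, h⟩ else 0
      have hρr : ∏ l, t l ^ ρ l = ∏ i, x i ^ r i := by
        rw [prod_pow_extend hed t r]
        simp_rw [hxt]
      have hρ0 : ∀ l, ρ l ≠ 0 → ¬ p ∣ ρ l := by
        intro l hl
        simp only [ρ] at hl ⊢
        split_ifs at hl ⊢ with h
        · exact hrp _ hl
        · exact (hl rfl).elim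
      obtain ⟨m, hmd, t', a', hrange, hmpos, ha', hprod⟩ := exists_reorder t ρ
      refine ⟨d, m, hmd, t', a', g, hgu, by rw [hrange, ht], hd, hmpos ⟨Fin.castLE hed i₀, ?_⟩, fun j => ?_, ?_⟩
      · simp only [ρ]
        rw [dif_pos (show ((Fin.castLE hed i₀ : Fin d) : ℕ) < e from i₀.2)]
        exact hi₀
      · obtain ⟨l, hl0, hl⟩ := ha' j
        rw [hl]; exact hρ0 l hl0
      · rw [hkey, ← hρr, hprod]
    · -- all `bᵢ ≡ 0 (mod p)`: forms (2)/(3)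
      push Not at hr
      have hprod1 : ∏ i, x i ^ r i = 1 := Finset.prod_eq_one fun i _ => by rw [hr i, pow_zero]
      rw [hprod1, mul_one] at hkey
      obtain ⟨i, hi⟩ | ⟨γ, hγ, hγu⟩ := hunit
      · exfalso
        have hbi : (b i : O) = 0 := (CharP.cast_eq_zero_iff O p (b i)).mpr (Nat.dvd_of_mod_eq_zero (hr i))
        have hmem : gen i ∈ maximalIdeal O := by
          show (b i : O) * g + x i * δ (γx i) g ∈ maximalIdeal O
          rw [hbi, zero_mul, zero_add]
          exact Ideal.mul_mem_right _ _ (hx𝔪 i)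
        exact ((IsLocalRing.mem_maximalIdeal _).mp hmem) hi
      · by_cases hres : ∀ c : O, g - c ^ p ∉ maximalIdeal O
        · exact Or.inr (Or.inl ⟨g, hgu, hkey, hres⟩)
        · push Not at hres
          obtain ⟨c', hc'⟩ := hres
          refine Or.inr (Or.inr ⟨g, c', hkey, hc', fun h2 => ?_⟩)
          have hD := derivation_apply_mem_of_mem_sq (maximalIdeal O) (δ γ) h2
          rw [map_sub, derivation_pow_char (p := p), sub_zero] at hD
          exact ((IsLocalRing.mem_maximalIdeal _).mp hD) hγu
  · -- `g ∈ 𝔪`: exchange a parameter for `g`, form (1)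
    have hg𝔪 : g ∈ maximalIdeal O := (IsLocalRing.mem_maximalIdeal _).mpr hgu
    obtain ⟨i, hi⟩ | ⟨γ, hγ, hγu⟩ := hunit
    · exfalso
      have hmem : gen i ∈ maximalIdeal O :=
        Ideal.add_mem _ (Ideal.mul_mem_left _ _ hg𝔪) (Ideal.mul_mem_right _ _ (hx𝔪 i))
      exact ((IsLocalRing.mem_maximalIdeal _).mp hmem) hi
    · -- `γ = t l` for some `l`
      have hγt : ∃ l, t l = (γ : O) := by
        by_contra hno
        push Not at hno
        have hkill : ∀ g' ∈ Set.range t, δ γ g' = 0 := by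
          rintro _ ⟨l, rfl⟩
          exact hδ₀ γ ⟨t l, htΓ ⟨l, rfl⟩⟩ (fun h => hno l (congrArg Subtype.val h))
        have hmem := derivation_apply_mem_span_of_forall_eq_zero (δ γ) hkill (v := g) (by rw [ht]; exact hg𝔪)
        rw [ht] at hmem
        exact ((IsLocalRing.mem_maximalIdeal _).mp hmem) hγu
      obtain ⟨l, hl⟩ := hγt
      have hlx : ∀ i, Fin.castLE hed i ≠ l := by
        intro i h
        apply hγ i
        apply Subtype.ext
        rw [hγx_coe, ← hxt, h, hl]
      let t₂ : Fin d → O := Function.update t l g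
      have ht₂ : Ideal.span (Set.range t₂) = maximalIdeal O :=
        span_range_update_eq t ht l g hg𝔪 (δ γ) (by rw [hl]; exact hδ₁ γ)
          (fun l' hl' => hδ₀ γ ⟨t l', htΓ ⟨l', rfl⟩⟩
            (fun h => hl' (htinj (by rw [hl]; exact congrArg Subtype.val h)))) hγu
      have ht₂x : ∀ i, t₂ (Fin.castLE hed i) = x i := fun i => by
        rw [← hxt]; exact Function.update_of_ne (hlx i) g t
      have ht₂l : t₂ l = g := Function.update_self l g t
      left
      let ρ : Fin d → ℕ := fun l' => if l' = l then 1 else (if h : (l' : ℕ) < e then r ⟨l', h⟩ else 0)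
      have hle : ¬ ((l : ℕ) < e) := fun h => hlx ⟨l, h⟩ (Fin.ext rfl)
      have hρr : ∏ l', t₂ l' ^ ρ l' = g * ∏ i, x i ^ r i := by
        rw [← Finset.mul_prod_erase Finset.univ _ (Finset.mem_univ l)]
        congr 1
        · simp only [ρ, if_pos rfl, pow_one, ht₂l]
        · have h1 : ∏ i, x i ^ r i = ∏ l', t₂ l' ^ (if h : (l' : ℕ) < e then r ⟨l', h⟩ else 0) := by
            rw [prod_pow_extend hed t₂ r]
            exact Finset.prod_congr rfl fun i _ => by rw [ht₂x]
          rw [h1, ← Finset.prod_erase (f := fun l' => t₂ l' ^ (if h : (l' : ℕ) < e then r ⟨l', h⟩ else 0))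
            Finset.univ (a := l) (by simp only [dif_neg hle, pow_zero])]
          refine Finset.prod_congr rfl fun l' hl' => ?_
          simp only [ρ, if_neg (Finset.ne_of_mem_erase hl')]
      have hρ0 : ∀ l', ρ l' ≠ 0 → ¬ p ∣ ρ l' := by
        intro l' hl'
        simp only [ρ] at hl' ⊢
        split_ifs at hl' ⊢ with h1 h2
        · exact hp'.not_dvd_one
        · exact hrp _ hl'
        · exact (hl' rfl).elim
      obtain ⟨m, hmd, t', a', hrange, hmpos, ha', hprod⟩ := exists_reorder t₂ ρ
      refine ⟨d, m, hmd, t', a', 1, isUnit_one, by rw [hrange, ht₂], hd, hmpos ⟨l, by simp [ρ]⟩, fun j => ?_, ?_⟩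
      · obtain ⟨l', hl0, hl'⟩ := ha' j
        rw [hl']; exact hρ0 l' hl0
      · rw [hkey, one_mul, ← hρr, hprod]

end Main


end ReadOff

/-- **(G-alg) HOLDS** — kernel proof of the §8 support item `NuZeroReadOffOfPBasis p` (§9 `ReadOff.readOff_core`). [folklore] -/
theorem nuZeroReadOffOfPBasis_holds (p : ℕ) : NuZeroReadOffOfPBasis p := by
  intro hp O _ _ _ K _ _ _ Γ hΓ d e hed t b ht hd htΓ f hf hJ
  haveI : Fact p.Prime := hp
  exact ReadOff.readOff_core hΓ hed t (fun i => t (Fin.castLE hed i)) (fun _ => rfl) b ht hd htΓ f hf hJ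

/-- **LEMMA G HOLDS along the valuation, for EVERY ground field `k`** (kernel: (G-pb) `exists_isPBasisOver_locAtCentre` ✓ +
(G-alg) `nuZeroReadOffOfPBasis_holds` ✓ + glue `nuZeroReadOff_of_pBasis` ✓). [folklore] -/
theorem nuZeroReadOffAlongValuationAt_holds (p : ℕ) : NuZeroReadOffAlongValuationAt p :=
  nuZeroReadOff_of_pBasis p (nuZeroReadOffOfPBasis_holds p)

/-- **THE `k̄`-SLICE OF :219 MODULO THE LITERAL PRINT FACT ALONE** (Cossart 1987 `ν = 0` along `v`, Posva arXiv:2405.05735 App. A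
A.1.3): statement = :219 VERBATIM with the single extra instance binder `[IsAlgClosed k]`; every `p`, every valuation class
(`htd`, `hdefect`, `hndisc` unused); the OURS read-off is now DISCHARGED in kernel. [folklore] -/
theorem cleanLU3Defect_algClosed_of_cossart1987NuZero (p : ℕ) (hN : Cossart1987NuZeroAlongValuationAt p) :
    p.Prime →
    ∀ (k : Type) [Field k] [CharP k p] [IsAlgClosed k] (K : Type) [Field K] [Algebra k K]
    (O : ValuationSubring K) (A : Subalgebra k K), A.toSubring ≤ O.toSubring → A.FG → IsFractionRing A K →
    ringKrullDim A ≤ 3 → IsRegularLocalRing (locAtCentre A.toSubring O) →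
    ringKrullDim (locAtCentre A.toSubring O) = 3 →
    (∀ (T : Subring K) (hT : T ≤ O.toSubring), A.toSubring ≤ T → (subringCentre T O hT).IsMaximal) →
    ∀ g₀ : K, (∀ c : K, c ^ p ≠ g₀) →
    (∀ f₀ : K, ∃ f₁ : K, O.valuation (g₀ - f₁ ^ p) < O.valuation (g₀ - f₀ ^ p)) →
    (∀ hk : ∀ c : k, algebraMap k K c ∈ O, transcendenceDefect k O hk ≠ 0) →
    ¬ (∃ π : K, π ≠ 0 ∧ (∀ x : K, O.valuation x < 1 → O.valuation x ≤ O.valuation π) ∧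
      (∀ x : K, x ≠ 0 → ∃ n : ℕ, O.valuation π ^ n ≤ O.valuation x)) →
    ∃ (A' : Subalgebra k K), A'.toSubring ≤ O.toSubring ∧ A ≤ A' ∧ A'.FG ∧
    ∃ (_ : IsRegularLocalRing (locAtCentre A'.toSubring O)) (c : Fin p → K), (∃ j : Fin p, (j : ℕ) ≠ 0 ∧ c j ≠ 0) ∧
    ((∃ (d m : ℕ) (hmd : m ≤ d) (t : Fin d → ↥(locAtCentre A'.toSubring O)) (a : Fin m → ℕ) (u : ↥(locAtCentre A'.toSubring O)), IsUnit u ∧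
    Ideal.span (Set.range t) = IsLocalRing.maximalIdeal ↥(locAtCentre A'.toSubring O) ∧
    ringKrullDim ↥(locAtCentre A'.toSubring O) = (d : WithBot ℕ∞) ∧ 0 < m ∧ (∀ i, ¬ p ∣ a i) ∧
    (∑ j : Fin p, c j ^ p * g₀ ^ (j : ℕ)) = (u : K) * ∏ i : Fin m, ((t (Fin.castLE hmd i) : ↥(locAtCentre A'.toSubring O)) : K) ^ (a i)) ∨
    (∃ u : ↥(locAtCentre A'.toSubring O), IsUnit u ∧ (∑ j : Fin p, c j ^ p * g₀ ^ (j : ℕ)) = (u : K) ∧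
    ∀ c' : ↥(locAtCentre A'.toSubring O), u - c' ^ p ∉ IsLocalRing.maximalIdeal ↥(locAtCentre A'.toSubring O)) ∨
    (∃ s c' : ↥(locAtCentre A'.toSubring O), (∑ j : Fin p, c j ^ p * g₀ ^ (j : ℕ)) = (s : K) ∧
    s - c' ^ p ∈ IsLocalRing.maximalIdeal ↥(locAtCentre A'.toSubring O) ∧
    s - c' ^ p ∉ IsLocalRing.maximalIdeal ↥(locAtCentre A'.toSubring O) ^ 2)) :=
  cleanLU3Defect_algClosed_of_nuZero p hN (nuZeroReadOffAlongValuationAt_holds p)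

/-- **THE PERFECT-FIELD SLICE OF :219 MODULO THE RESEARCH PROP F-eq ALONE** (`CossartNuZeroAlongValuationAtPerfect p` =
«Gal-stable Cossart centres along `v`», OPEN in print): statement = :219 verbatim with `[PerfectField k]`. [folklore] -/
theorem cleanLU3Defect_perfect_of_equivariantCossartNuZero (p : ℕ) (hN : CossartNuZeroAlongValuationAtPerfect p) :
    p.Prime →
    ∀ (k : Type) [Field k] [CharP k p] [PerfectField k] (K : Type) [Field K] [Algebra k K]
    (O : ValuationSubring K) (A : Subalgebra k K), A.toSubring ≤ O.toSubring → A.FG → IsFractionRing A K →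
    ringKrullDim A ≤ 3 → IsRegularLocalRing (locAtCentre A.toSubring O) →
    ringKrullDim (locAtCentre A.toSubring O) = 3 →
    (∀ (T : Subring K) (hT : T ≤ O.toSubring), A.toSubring ≤ T → (subringCentre T O hT).IsMaximal) →
    ∀ g₀ : K, (∀ c : K, c ^ p ≠ g₀) →
    (∀ f₀ : K, ∃ f₁ : K, O.valuation (g₀ - f₁ ^ p) < O.valuation (g₀ - f₀ ^ p)) →
    (∀ hk : ∀ c : k, algebraMap k K c ∈ O, transcendenceDefect k O hk ≠ 0) →
    ¬ (∃ π : K, π ≠ 0 ∧ (∀ x : K, O.valuation x < 1 → O.valuation x ≤ O.valuation π) ∧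
      (∀ x : K, x ≠ 0 → ∃ n : ℕ, O.valuation π ^ n ≤ O.valuation x)) →
    ∃ (A' : Subalgebra k K), A'.toSubring ≤ O.toSubring ∧ A ≤ A' ∧ A'.FG ∧
    ∃ (_ : IsRegularLocalRing (locAtCentre A'.toSubring O)) (c : Fin p → K), (∃ j : Fin p, (j : ℕ) ≠ 0 ∧ c j ≠ 0) ∧
    ((∃ (d m : ℕ) (hmd : m ≤ d) (t : Fin d → ↥(locAtCentre A'.toSubring O)) (a : Fin m → ℕ) (u : ↥(locAtCentre A'.toSubring O)), IsUnit u ∧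
    Ideal.span (Set.range t) = IsLocalRing.maximalIdeal ↥(locAtCentre A'.toSubring O) ∧
    ringKrullDim ↥(locAtCentre A'.toSubring O) = (d : WithBot ℕ∞) ∧ 0 < m ∧ (∀ i, ¬ p ∣ a i) ∧
    (∑ j : Fin p, c j ^ p * g₀ ^ (j : ℕ)) = (u : K) * ∏ i : Fin m, ((t (Fin.castLE hmd i) : ↥(locAtCentre A'.toSubring O)) : K) ^ (a i)) ∨
    (∃ u : ↥(locAtCentre A'.toSubring O), IsUnit u ∧ (∑ j : Fin p, c j ^ p * g₀ ^ (j : ℕ)) = (u : K) ∧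
    ∀ c' : ↥(locAtCentre A'.toSubring O), u - c' ^ p ∉ IsLocalRing.maximalIdeal ↥(locAtCentre A'.toSubring O)) ∨
    (∃ s c' : ↥(locAtCentre A'.toSubring O), (∑ j : Fin p, c j ^ p * g₀ ^ (j : ℕ)) = (s : K) ∧
    s - c' ^ p ∈ IsLocalRing.maximalIdeal ↥(locAtCentre A'.toSubring O) ∧
    s - c' ^ p ∉ IsLocalRing.maximalIdeal ↥(locAtCentre A'.toSubring O) ^ 2)) :=
  cleanLU3Defect_perfect_of_equivariantCossart p hN (nuZeroReadOffAlongValuationAt_holds p)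


/-! ## 10. The GLOBAL print theorem implies the along-valuation fact (rev 6): `Cossart1987Thm → Cossart1987NuZeroAlongValuationAt p`

The «routine affine-chart plumbing» of §5's docstring, IN KERNEL: (a) `NuZeroAt` is invariant under ring isomorphisms
(`NuZeroAt.of_ringEquiv`, conjugating derivations); (b) a finitely generated model regular of dimension `3` at the closed centre
is dominated inside `O` by an everywhere-regular affine model `A₁ = A[1/h]` of dimension `3` (`exists_regularAffineModel₃`, the
landed dimension-`2` ✓ `exists_regularAffineModel_of_regularAtCentre` with `2 ↦ 3`: openness of the regular locus over a field,
✓ `isOpen_regularLocus_of_finiteType_field`); (c) `f ∈ A`, not a `p`-th power in `K`, is not a `p`-th power in `K(Spec A₁)`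
(`not_pthPower_functionField`); (d) apply `Cossart1987Thm` to `(Spec A₁ → Spec k̄, f)`; the output `π : X' → Spec A₁` is proper,
birational and dominant (`isBirational_and_denseRange`); (e) the LANDED extraction ✓ `exists_model_of_proper_birational` (lead,
`Theorems/RadicialJungCleanModelsCleanLU2Extraction.lean`: valuative criterion + affine neighbourhood of the centre, WITH the stalk
isomorphism `δ : 𝒪_{X',x} ≅ locAtCentre T O` and the function-field identification `Θ`) carries the germ of `π^* f` to `f`;
(f) transport `ν = 0` and regularity along `δ`, re-base `T` over `k` (`Algebra.adjoin_union_eq_adjoin_adjoin`).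
CONSEQUENCE: `cleanLU3Defect_algClosed_of_cossart1987Thm` — the `k̄`-slice of :219 for every `p` and every valuation class
MODULO THE GLOBAL LITERAL PRINT THEOREM `Cossart1987Thm` ALONE (typed exactly like the tree's ✓-consumed `Giraud1983Thm24`).
-/

section GlobalToLocal

open CategoryTheory AlgebraicGeometry TopologicalSpace
open Literature.AlgebraicGeometry.CossartPiltant200819.CP2008
open Literature.AlgebraicGeometry.Motives

/-- Conjugating a derivation by a ring isomorphism: `D ↦ e⁻¹ ∘ D ∘ e`. [folklore] -/
def derivationConj {S S' : Type} [CommRing S] [CommRing S'] (e : S ≃+* S') (D : Derivation ℤ S' S') :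
    Derivation ℤ S S where
  toFun x := e.symm (D (e x))
  map_add' x y := by simp [map_add]
  map_smul' n x := by simp
  map_one_eq_zero' := by simp
  leibniz' x y := by
    change e.symm (D (e (x * y))) = x * e.symm (D (e y)) + y * e.symm (D (e x))
    rw [map_mul, Derivation.leibniz, smul_eq_mul, smul_eq_mul, map_add, map_mul, map_mul,
      e.symm_apply_apply, e.symm_apply_apply]

@[simp] theorem derivationConj_apply {S S' : Type} [CommRing S] [CommRing S'] (e : S ≃+* S')
    (D : Derivation ℤ S' S') (x : S) : derivationConj e D x = e.symm (D (e x)) := rfl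

/-- `NuZeroAt` is invariant under ring isomorphisms of local rings. [folklore] -/
theorem NuZeroAt.of_ringEquiv {S S' : Type} [CommRing S] [IsLocalRing S] [CommRing S'] [IsLocalRing S']
    (e : S ≃+* S') {f : S} (h : NuZeroAt f) : NuZeroAt (e f) := by
  obtain ⟨d, n, hnd, t, b, ht, hd, hJ⟩ := h
  refine ⟨d, n, hnd, e ∘ t, b, ?_, ?_, ?_⟩
  · have h1 : Ideal.span (Set.range (e ∘ t)) = Ideal.map e.toRingHom (Ideal.span (Set.range t)) := by
      rw [Ideal.map_span, Set.range_comp]; rfl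
    rw [h1, ht]
    -- the image of the maximal ideal is the maximal ideal
    have hmax : (Ideal.map e.toRingHom (maximalIdeal S)).IsMaximal :=
      (maximalIdeal.isMaximal S).map_bijective e.toRingHom e.bijective
    exact (IsLocalRing.eq_maximalIdeal hmax)
  · rw [← hd]; exact (ringKrullDim_eq_of_ringEquiv e).symm
  · -- the log-Jacobian sets correspond under `e`
    have hset : {v : S' | ∃ D : Derivation ℤ S' S',
        (∀ i : Fin n, (e ∘ t) (Fin.castLE hnd i) ∣ D ((e ∘ t) (Fin.castLE hnd i))) ∧ D (e f) = v} =
        e.toRingHom '' {v : S | ∃ D : Derivation ℤ S S,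
          (∀ i : Fin n, t (Fin.castLE hnd i) ∣ D (t (Fin.castLE hnd i))) ∧ D f = v} := by
      ext v
      simp only [Set.mem_setOf_eq, Set.mem_image, Function.comp_apply, RingEquiv.toRingHom_eq_coe,
        RingHom.coe_coe]
      constructor
      · rintro ⟨D, hD, rfl⟩
        refine ⟨derivationConj e D f, ⟨derivationConj e D, fun i => ?_, rfl⟩, by simp⟩
        obtain ⟨c, hc⟩ := hD i
        refine ⟨e.symm c, ?_⟩
        rw [derivationConj_apply, hc, map_mul, e.symm_apply_apply]
      · rintro ⟨v, ⟨D, hD, rfl⟩, rfl⟩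
        refine ⟨derivationConj e.symm D, fun i => ?_, by simp⟩
        obtain ⟨c, hc⟩ := hD i
        refine ⟨e c, ?_⟩
        rw [derivationConj_apply, e.symm_symm, e.symm_apply_apply, hc, map_mul]
    have h2 : Ideal.span (e.toRingHom '' {v : S | ∃ D : Derivation ℤ S S,
          (∀ i : Fin n, t (Fin.castLE hnd i) ∣ D (t (Fin.castLE hnd i))) ∧ D f = v}) =
        Ideal.span (e.toRingHom '' {∏ i : Fin n, t (Fin.castLE hnd i) ^ b i}) := by
      rw [← Ideal.map_span, hJ, Ideal.map_span]
    rw [hset, h2]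
    congr 1
    simp only [Set.image_singleton, RingEquiv.toRingHom_eq_coe, RingHom.coe_coe, map_prod, map_pow,
      Function.comp_apply]


/-- **Regular affine model in dimension `3`** (Steps 1–4a of the landed dimension-`2` version
✓ `exists_regularAffineModel_of_regularAtCentre`, with `2 ↦ 3`): a finitely generated model `A ⊆ O` of `K/k`, regular of
dimension `3` at the (closed) centre of `O`, is dominated by `A₁ = A[1/h] ⊆ O`, finitely generated, `Frac A₁ = K`, REGULAR
EVERYWHERE, `dim A₁ = 3` (openness of the regular locus of a finitely generated algebra over a field, ✓ `FieldsJ2`). [folklore] -/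
theorem exists_regularAffineModel₃ (k : Type) [Field k] (K : Type) [Field K] [Algebra k K]
    (O : ValuationSubring K) (A : Subalgebra k K)
    (hAO : A.toSubring ≤ O.toSubring) (hAfg : A.FG) (hfrac : IsFractionRing A K)
    (hreg : IsRegularLocalRing (locAtCentre A.toSubring O))
    (hdim : ringKrullDim (locAtCentre A.toSubring O) = 3)
    (hmax : (subringCentre A.toSubring O hAO).IsMaximal) :
    ∃ (A₁ : Subalgebra k K), A₁.toSubring ≤ O.toSubring ∧ A ≤ A₁ ∧ A₁.FG ∧ IsFractionRing A₁ K ∧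
      IsRegularRing A₁ ∧ ringKrullDim A₁ = 3 := by
  haveI : IsFractionRing A K := hfrac
  have hdimA : ringKrullDim A = 3 := by
    rw [← ringKrullDim_locAtCentre_eq_of_isMaximal A hAfg O hAO hmax]; exact hdim
  haveI : Algebra.FiniteType k A := A.fg_iff_finiteType.mp hAfg
  have hregOpen : IsOpen (regularLocus A) := isOpen_regularLocus_of_finiteType_field k A
  let 𝔮 := subringCentre A.toSubring O hAO
  haveI : 𝔮.IsPrime := subringCentre.isPrime A.toSubring O hAO
  have hreg_loc : IsRegularLocalRing (Localization.AtPrime 𝔮) := by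
    rw [← isRegularLocalRing_locAtCentre_iff hAO]; exact hreg
  let P : PrimeSpectrum A := ⟨𝔮, inferInstance⟩
  have hPreg : P ∈ regularLocus A := by rw [mem_regularLocus]; exact hreg_loc
  haveI : IsNoetherianRing A := Algebra.FiniteType.isNoetherianRing k A
  obtain ⟨U, ⟨h, rfl⟩, hhP, hhU⟩ :=
    PrimeSpectrum.isTopologicalBasis_basic_opens.exists_subset_of_mem_open hPreg hregOpen
  have hh𝔮 : h ∉ 𝔮 := hhP
  have hvh : O.valuation (h : K) = 1 := by
    have hle : O.valuation (h : K) ≤ 1 := O.valuation_le_one ⟨h, hAO h.2⟩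
    have hnlt : ¬ O.valuation (h : K) < 1 := fun hlt => hh𝔮 (by rw [mem_subringCentre_iff]; exact hlt)
    exact le_antisymm hle (not_lt.mp hnlt)
  have hh0 : (h : K) ≠ 0 := fun h0 => by rw [h0, map_zero] at hvh; exact zero_ne_one hvh
  have hhinvO : (h : K)⁻¹ ∈ O := by
    rw [← ValuationSubring.valuation_le_one_iff, map_inv₀, hvh, inv_one]
  obtain ⟨s₀, rfl⟩ := hAfg
  let s₁ : Set K := insert (h : K)⁻¹ (s₀ : Set K)
  let A₁ := Algebra.adjoin k s₁
  have hle : Algebra.adjoin k (s₀ : Set K) ≤ A₁ := Algebra.adjoin_mono (Set.subset_insert _ _)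
  have hA₁O : A₁.toSubring ≤ O.toSubring := by
    have h1 : A₁ ≤ { carrier := (O : Set K)
                     mul_mem' := fun ha hb => O.toSubring.mul_mem ha hb
                     one_mem' := O.toSubring.one_mem
                     add_mem' := fun ha hb => O.toSubring.add_mem ha hb
                     zero_mem' := O.toSubring.zero_mem
                     algebraMap_mem' := fun c => hAO ((Algebra.adjoin k (s₀ : Set K)).algebraMap_mem c) } := by
      refine Algebra.adjoin_le ?_
      rintro z (rfl | hz)
      · exact hhinvO
      · exact hAO (Algebra.subset_adjoin hz)
    exact fun z hz => h1 hz
  haveI hfr₁ : IsFractionRing A₁ K := isFractionRing_of_le hle hfrac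
  have hA₁fg : A₁.FG := by
    classical
    exact ⟨insert (h : K)⁻¹ s₀, by push_cast; rfl⟩
  haveI : Algebra.FiniteType k A₁ := A₁.fg_iff_finiteType.mp hA₁fg
  haveI hNR₁ : IsNoetherianRing A₁ := Algebra.FiniteType.isNoetherianRing k A₁
  have hregA₁ : IsRegularRing A₁ := isRegularRing_adjoin_insert_inv (s₀ : Set K) h hh0 hhU
  have htrdeg : Algebra.trdeg k K = 3 := by
    rw [trdeg_eq_trdeg_of_isFractionRing (Algebra.adjoin k (s₀ : Set K))]
    obtain ⟨n, hn, htr⟩ := exists_ringKrullDim_eq_and_trdeg_eq k (Algebra.adjoin k (s₀ : Set K))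
    rw [hdimA] at hn
    have hn3 : n = 3 := by exact_mod_cast hn.symm
    rw [htr, hn3]; rfl
  have hA₁dim : ringKrullDim A₁ = 3 := by
    obtain ⟨n, hn, htr⟩ := exists_ringKrullDim_eq_and_trdeg_eq k A₁
    rw [← trdeg_eq_trdeg_of_isFractionRing A₁, htrdeg] at htr
    have hn3 : n = 3 := by exact_mod_cast htr.symm
    rw [hn, hn3]; rfl
  exact ⟨A₁, hA₁O, hle, hA₁fg, hfr₁, hregA₁, hA₁dim⟩

/-! ### Spec-level facts -/

/-- The structure morphism `Spec A ⟶ Spec k` of a finitely generated `k`-algebra is locally of finite type. [folklore] -/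
theorem locallyOfFiniteType_Spec (k : Type) [Field k] (A : Type) [CommRing A] [Algebra k A] [Algebra.FiniteType k A] :
    LocallyOfFiniteType (Spec.map (CommRingCat.ofHom (algebraMap k A))) :=
  (HasRingHomProperty.Spec_iff (P := @LocallyOfFiniteType)).mpr (RingHom.finiteType_algebraMap.mpr ‹_›)

/-- A morphism of integral schemes which is an isomorphism over a non-empty open is birational and dominant. [folklore] -/
theorem isBirational_and_denseRange {X' X : Scheme.{0}} [IsIntegral X'] [IsIntegral X] (π : X' ⟶ X)
    (U : X.Opens) (hU : (U : Set X).Nonempty) [IsIso (π ∣_ U)] :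
    IsBirational π ∧ DenseRange π.base := by
  -- a point of `π ⁻¹ U` over each point of `U`
  have hsurj : Function.Surjective (π ∣_ U).base :=
    (Scheme.homeoOfIso (asIso (π ∣_ U))).surjective
  have hsub : (U : Set X) ⊆ Set.range π.base := by
    intro u hu
    obtain ⟨y, hy⟩ := hsurj ⟨u, hu⟩
    refine ⟨(π ⁻¹ᵁ U).ι.base y, ?_⟩
    have := congrArg (fun f => f.base y) (morphismRestrict_ι π U)
    change (π ∣_ U ≫ U.ι) y = ((π ⁻¹ᵁ U).ι ≫ π) y at this
    rw [Scheme.Hom.comp_apply, Scheme.Hom.comp_apply, hy] at this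
    exact this.symm
  have hUd : Dense (U : Set X) := U.isOpen.dense hU
  have hpre : ((π ⁻¹ᵁ U : X'.Opens) : Set X').Nonempty := by
    obtain ⟨u, hu⟩ := hU
    obtain ⟨y, _⟩ := hsurj ⟨u, hu⟩
    exact ⟨(π ⁻¹ᵁ U).ι.base y, by
      have := Scheme.Opens.range_ι (π ⁻¹ᵁ U)
      rw [← this]; exact ⟨y, rfl⟩⟩
  exact ⟨⟨U, hUd, (π ⁻¹ᵁ U).isOpen.dense hpre, inferInstance⟩, hUd.mono hsub⟩

/-- On `Spec R` (`R` a domain with fraction field `K`), a global section whose image in `K` is not a `p`-th power is not a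
`p`-th power in the function field. [folklore] -/
theorem not_pthPower_functionField (R : CommRingCat.{0}) [IsDomain R] (K : Type) [Field K] [Algebra R K]
    [IsFractionRing R K] (p : ℕ) (a : R) (ha : ∀ c : K, c ^ p ≠ algebraMap R K a) :
    ∀ c : (Spec R).functionField,
      c ^ p ≠ ((Spec R).presheaf.germ ⊤ (genericPoint (Spec R)) trivial) ((Scheme.ΓSpecIso R).inv a) := by
  intro c hc
  -- `K(Spec R)` and `K` are both fraction fields of `R`
  let e : (Spec R).functionField ≃ₐ[R] K := IsLocalization.algEquiv (nonZeroDivisors R) _ _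
  apply ha (e c)
  have h1 : e (algebraMap R (Spec R).functionField a) = algebraMap R K a := e.commutes a
  rw [← RatFn.algebraMap_functionField_Spec] at hc
  rw [← h1, ← map_pow, hc]

/-- Transport of «regular at the centre, `f` in the local ring, `ν = 0`» along an equality of subrings. [folklore] -/
theorem nuZeroAtCentre_of_toSubring_eq {K : Type} [Field K] (O : ValuationSubring K) {S S' : Subring K}
    (e : S' = S) (f : K)
    (h : ∃ (_ : IsRegularLocalRing (locAtCentre S O)) (hf : f ∈ locAtCentre S O),
      NuZeroAt (⟨f, hf⟩ : ↥(locAtCentre S O))) :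
    ∃ (_ : IsRegularLocalRing (locAtCentre S' O)) (hf : f ∈ locAtCentre S' O),
      NuZeroAt (⟨f, hf⟩ : ↥(locAtCentre S' O)) := by
  subst e; exact h

open Summit.ResolutionOfSingularities.ResolutionOfSingularities.Theorems.RadicialJung.CleanModels in
/-- **Cossart 1987 GLOBAL ⟹ Cossart 1987 along a zero-dimensional valuation** (the «routine affine-chart plumbing» of
the anchor's §5 docstring, now in kernel): restrict to a regular affine neighbourhood `Spec A₁` of the closed centre
(`exists_regularAffineModel₃`), apply the global theorem to `(Spec A₁, f)`, lift `Spec O → Spec A₁` to the proper model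
`X' → Spec A₁` by the valuative criterion and extract a finitely generated model `T ⊆ O` with `𝒪_{X',x} ≅ locAtCentre T O`
carrying the germ of `π^* f` to `f` (✓ `exists_model_of_proper_birational`), transport `ν = 0` along the ring isomorphism
(`NuZeroAt.of_ringEquiv`), and re-base `T` over `k`. [folklore] -/
theorem cossart1987NuZeroAlongValuationAt_of_thm (p : ℕ) (h : Cossart1987Thm) :
    Cossart1987NuZeroAlongValuationAt p := by
  intro hp k _ _ _ K _ _ O A hAO hAfg hfr _hdimA hreg hdim3 hzd f hfA hfp
  classical
  haveI : Fact p.Prime := hp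
  -- Step 1: a regular affine model `A₁ ⊇ A` inside `O`
  obtain ⟨A₁, hA₁O, hAA₁, hA₁fg, hfr₁, hregA₁, hdimA₁⟩ :=
    exists_regularAffineModel₃ k K O A hAO hAfg hfr hreg hdim3 (hzd _ hAO le_rfl)
  obtain ⟨s₁, rfl⟩ := hA₁fg
  set A₁ := Algebra.adjoin k (s₁ : Set K) with hA₁def
  haveI := hfr₁
  haveI : IsRegularRing A₁ := hregA₁
  haveI : Algebra.FiniteType k A₁ := A₁.fg_iff_finiteType.mp ⟨s₁, rfl⟩
  haveI : IsNoetherianRing A₁ := Algebra.FiniteType.isNoetherianRing k A₁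
  -- Step 2: the scheme `X = Spec A₁` over `k`
  let R : CommRingCat.{0} := CommRingCat.of A₁
  haveI : IsDomain R := inferInstanceAs (IsDomain A₁)
  haveI : IsRegularRing R := inferInstanceAs (IsRegularRing A₁)
  letI : Algebra R K := inferInstanceAs (Algebra A₁ K)
  haveI : IsFractionRing R K := inferInstanceAs (IsFractionRing A₁ K)
  let X : Scheme.{0} := Spec R
  let sX : X ⟶ Spec (.of k) := Spec.map (CommRingCat.ofHom (algebraMap k A₁))
  haveI : LocallyOfFiniteType sX := locallyOfFiniteType_Spec k A₁
  haveI : IsSeparated sX := inferInstanceAs (IsSeparated (Spec.map (CommRingCat.ofHom (algebraMap k A₁))))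
  have hXreg : Scheme.IsRegular X := Scheme.isRegular_Spec R
  have hXdim : topologicalKrullDim X = 3 :=
    (PrimeSpectrum.topologicalKrullDim_eq_ringKrullDim (R := A₁)).trans hdimA₁
  -- the global section `f`
  let a : R := (⟨f, hAA₁ hfA⟩ : A₁)
  let fX : Γ(X, ⊤) := (Scheme.ΓSpecIso R).inv a
  have hfX : ∀ c : X.functionField, c ^ p ≠ (X.presheaf.germ ⊤ (genericPoint X) trivial) fX :=
    not_pthPower_functionField R K p a (fun c hc => hfp c hc)
  -- Step 3: Cossart's theorem on `(X, f)`
  have hXqp : Literature.AlgebraicGeometry.CossartPiltant200819.CP2008.IsQuasiProjectiveOver sX :=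
    Literature.AlgebraicGeometry.CossartPiltant200819.CP2008.isQuasiProjectiveOver_of_isAffine sX
  obtain ⟨X', π, hπ, hX'int, hX'reg, ⟨U, hUne, hUiso⟩, hν⟩ := h p k X sX hXqp hXreg hXdim fX hfX
  haveI := hπ
  haveI := hX'int
  haveI := hUiso
  obtain ⟨hbir, hdense⟩ := isBirational_and_denseRange π U hUne
  haveI : IsDominant π := ⟨hdense⟩
  -- Step 4: extraction of a finitely generated model at the centre of `O` on `X'`
  obtain ⟨x, T, hTO, hTfg, δ, Θ, hΘδ, hΘπ⟩ :=
    exists_model_of_proper_birational (A := A₁) (K := K) O (fun b => hA₁O b.2) π hπ hbir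
  -- Step 5: the germ of `π^* f` at `x` is carried to `f`
  let gx : X'.presheaf.stalk x := X'.presheaf.germ ⊤ x trivial (π.appTop fX)
  have hνx : NuZeroAt gx := hν x
  have hgen : algebraMap (X'.presheaf.stalk x) X'.functionField gx =
      RatFn.functionFieldMap π (X.presheaf.germ ⊤ (genericPoint X) trivial fX) := by
    have h2 : gx = π.stalkMap x (X.presheaf.germ ⊤ (π.base x) trivial fX) := by
      rw [Scheme.Hom.germ_stalkMap_apply]; rfl
    rw [h2]
    change RatFn.toFunctionField x (π.stalkMap x _) = _
    rw [← RatFn.functionFieldMap_toFunctionField]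
    congr 1
    haveI : Nonempty (⊤ : X.Opens) := ⟨⟨genericPoint X, Set.mem_univ _⟩⟩
    exact Scheme.algebraMap_germ_eq_germToFunctionField (X := X) (U := ⊤) (x := π.base x) (Set.mem_univ _) fX
  have hgx : ((δ gx : ↥(locAtCentre T.toSubring O)) : K) = f := by
    rw [← hΘδ, hgen, hΘπ]
    change algebraMap A₁ K ((Scheme.ΓSpecIso R).hom ((Scheme.ΓSpecIso R).inv a)) = f
    rw [← CommRingCat.comp_apply, Iso.inv_hom_id, CommRingCat.id_apply]
    rfl
  -- Step 6: `f ∈ locAtCentre T O`, regular, `ν = 0` there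
  have hfT : f ∈ locAtCentre T.toSubring O := by rw [← hgx]; exact (δ gx).2
  haveI hregT : IsRegularLocalRing (locAtCentre T.toSubring O) := by
    haveI := hX'reg x
    exact IsRegularLocalRing.of_ringEquiv δ
  have hνT : NuZeroAt (⟨f, hfT⟩ : ↥(locAtCentre T.toSubring O)) := by
    have h1 := NuZeroAt.of_ringEquiv δ hνx
    have heq : δ gx = ⟨f, hfT⟩ := Subtype.ext hgx
    rwa [heq] at h1
  -- Step 7: re-base `T` over `k`
  obtain ⟨t, ht⟩ := hTfg
  have e : (Algebra.adjoin k ((s₁ : Set K) ∪ (t : Set K))).toSubring = T.toSubring := by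
    rw [Algebra.adjoin_union_eq_adjoin_adjoin, ← ht]; rfl
  refine ⟨Algebra.adjoin k ((s₁ : Set K) ∪ (t : Set K)), ?_, ?_, ⟨s₁ ∪ t, by push_cast; rfl⟩, ?_⟩
  · rw [e]; exact hTO
  · exact hAA₁.trans (Algebra.adjoin_mono Set.subset_union_left)
  · exact nuZeroAtCentre_of_toSubring_eq O e f ⟨hregT, hfT, hνT⟩

/-- **THE `k̄`-SLICE OF :219 MODULO THE GLOBAL LITERAL PRINT THEOREM ALONE** (rev 6): statement = :219 VERBATIM with the single
extra instance binder `[IsAlgClosed k]`, hypothesis = `Cossart1987Thm` (§7: Cossart 1987 as printed — a proper birational modification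
of a regular threefold over `k̄` with `ν = 0` everywhere, [Posva2024] App. A A.1.3), every `p`, every valuation class. [folklore] -/
theorem cleanLU3Defect_algClosed_of_cossart1987Thm (p : ℕ) (h : Cossart1987Thm) :
    p.Prime →
    ∀ (k : Type) [Field k] [CharP k p] [IsAlgClosed k] (K : Type) [Field K] [Algebra k K]
    (O : ValuationSubring K) (A : Subalgebra k K), A.toSubring ≤ O.toSubring → A.FG → IsFractionRing A K →
    ringKrullDim A ≤ 3 → IsRegularLocalRing (locAtCentre A.toSubring O) →
    ringKrullDim (locAtCentre A.toSubring O) = 3 →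
    (∀ (T : Subring K) (hT : T ≤ O.toSubring), A.toSubring ≤ T → (subringCentre T O hT).IsMaximal) →
    ∀ g₀ : K, (∀ c : K, c ^ p ≠ g₀) →
    (∀ f₀ : K, ∃ f₁ : K, O.valuation (g₀ - f₁ ^ p) < O.valuation (g₀ - f₀ ^ p)) →
    (∀ hk : ∀ c : k, algebraMap k K c ∈ O, transcendenceDefect k O hk ≠ 0) →
    ¬ (∃ π : K, π ≠ 0 ∧ (∀ x : K, O.valuation x < 1 → O.valuation x ≤ O.valuation π) ∧
      (∀ x : K, x ≠ 0 → ∃ n : ℕ, O.valuation π ^ n ≤ O.valuation x)) →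
    ∃ (A' : Subalgebra k K), A'.toSubring ≤ O.toSubring ∧ A ≤ A' ∧ A'.FG ∧
    ∃ (_ : IsRegularLocalRing (locAtCentre A'.toSubring O)) (c : Fin p → K), (∃ j : Fin p, (j : ℕ) ≠ 0 ∧ c j ≠ 0) ∧
    ((∃ (d m : ℕ) (hmd : m ≤ d) (t : Fin d → ↥(locAtCentre A'.toSubring O)) (a : Fin m → ℕ) (u : ↥(locAtCentre A'.toSubring O)), IsUnit u ∧
    Ideal.span (Set.range t) = IsLocalRing.maximalIdeal ↥(locAtCentre A'.toSubring O) ∧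
    ringKrullDim ↥(locAtCentre A'.toSubring O) = (d : WithBot ℕ∞) ∧ 0 < m ∧ (∀ i, ¬ p ∣ a i) ∧
    (∑ j : Fin p, c j ^ p * g₀ ^ (j : ℕ)) = (u : K) * ∏ i : Fin m, ((t (Fin.castLE hmd i) : ↥(locAtCentre A'.toSubring O)) : K) ^ (a i)) ∨
    (∃ u : ↥(locAtCentre A'.toSubring O), IsUnit u ∧ (∑ j : Fin p, c j ^ p * g₀ ^ (j : ℕ)) = (u : K) ∧
    ∀ c' : ↥(locAtCentre A'.toSubring O), u - c' ^ p ∉ IsLocalRing.maximalIdeal ↥(locAtCentre A'.toSubring O)) ∨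
    (∃ s c' : ↥(locAtCentre A'.toSubring O), (∑ j : Fin p, c j ^ p * g₀ ^ (j : ℕ)) = (s : K) ∧
    s - c' ^ p ∈ IsLocalRing.maximalIdeal ↥(locAtCentre A'.toSubring O) ∧
    s - c' ^ p ∉ IsLocalRing.maximalIdeal ↥(locAtCentre A'.toSubring O) ^ 2)) :=
  cleanLU3Defect_algClosed_of_cossart1987NuZero p (cossart1987NuZeroAlongValuationAt_of_thm p h)

end GlobalToLocal


/-! ## 11. Over `k̄` the anchor gives the WHOLE zero-dimensional clean LU of the Sketch (`cleanLU3_of_stubs`, Sketch.lean :279), not only :219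

The class hypotheses of :219 being unused, the same chain proves the statement of the lead's kernel composition `cleanLU3_of_stubs`
(Sketch.lean :279–297: ALL zero-dimensional valuation classes with a 3-dimensional regular centre, hypotheses only up to `g₀ ∉ K^p`) —
the input of the LANDED 4a variant ✓ `cleanCharts3_of_cleanLU3ZeroDim` — VERBATIM with the single extra binder `[IsAlgClosed k]`, from
`Cossart1987Thm` ALONE: over `k̄` neither CJS 2020 (F-32, `stub_cjs2020Thm14`/`stub_cjs2020Cor15`) nor the landed defectless / Abhyankar
halves nor the research stub :219 are needed at this node.
-/

/-- Root form: :279 verbatim + `[IsAlgClosed k]` from the literal along-`v` fact and the read-off (both discharged below). [folklore] -/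
theorem cleanLU3_algClosed_of_nuZero (p : ℕ) (hN : Cossart1987NuZeroAlongValuationAt p)
    (hR : NuZeroReadOffAlongValuationAt p) :
    p.Prime →
    ∀ (k : Type) [Field k] [CharP k p] [IsAlgClosed k] (K : Type) [Field K] [Algebra k K]
    (O : ValuationSubring K) (A : Subalgebra k K), A.toSubring ≤ O.toSubring → A.FG → IsFractionRing A K →
    ringKrullDim A ≤ 3 → IsRegularLocalRing (locAtCentre A.toSubring O) →
    ringKrullDim (locAtCentre A.toSubring O) = 3 →
    (∀ (T : Subring K) (hT : T ≤ O.toSubring), A.toSubring ≤ T → (subringCentre T O hT).IsMaximal) →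
    ∀ g₀ : K, (∀ c : K, c ^ p ≠ g₀) →
    ∃ (A' : Subalgebra k K), A'.toSubring ≤ O.toSubring ∧ A ≤ A' ∧ A'.FG ∧
    ∃ (_ : IsRegularLocalRing (locAtCentre A'.toSubring O)) (c : Fin p → K), (∃ j : Fin p, (j : ℕ) ≠ 0 ∧ c j ≠ 0) ∧
    ((∃ (d m : ℕ) (hmd : m ≤ d) (t : Fin d → ↥(locAtCentre A'.toSubring O)) (a : Fin m → ℕ) (u : ↥(locAtCentre A'.toSubring O)), IsUnit u ∧
    Ideal.span (Set.range t) = IsLocalRing.maximalIdeal ↥(locAtCentre A'.toSubring O) ∧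
    ringKrullDim ↥(locAtCentre A'.toSubring O) = (d : WithBot ℕ∞) ∧ 0 < m ∧ (∀ i, ¬ p ∣ a i) ∧
    (∑ j : Fin p, c j ^ p * g₀ ^ (j : ℕ)) = (u : K) * ∏ i : Fin m, ((t (Fin.castLE hmd i) : ↥(locAtCentre A'.toSubring O)) : K) ^ (a i)) ∨
    (∃ u : ↥(locAtCentre A'.toSubring O), IsUnit u ∧ (∑ j : Fin p, c j ^ p * g₀ ^ (j : ℕ)) = (u : K) ∧
    ∀ c' : ↥(locAtCentre A'.toSubring O), u - c' ^ p ∉ IsLocalRing.maximalIdeal ↥(locAtCentre A'.toSubring O)) ∨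
    (∃ s c' : ↥(locAtCentre A'.toSubring O), (∑ j : Fin p, c j ^ p * g₀ ^ (j : ℕ)) = (s : K) ∧
    s - c' ^ p ∈ IsLocalRing.maximalIdeal ↥(locAtCentre A'.toSubring O) ∧
    s - c' ^ p ∉ IsLocalRing.maximalIdeal ↥(locAtCentre A'.toSubring O) ^ 2)) := by
  intro hp k _ _ _ K _ _ O A hAO hAfg hfrac hdimA hreg hdim3 hzd g₀ hg₀
  classical
  haveI : Fact p.Prime := ⟨hp⟩
  haveI := hfrac
  obtain ⟨b, hb0, hbA, hfA⟩ := exists_pow_mul_mem p hp A g₀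
  set f : K := b ^ p * g₀ with hfdef
  have hf : ∀ c : K, c ^ p ≠ f := by
    intro c hc
    apply hg₀ (c / b)
    rw [div_pow, hc, hfdef, mul_comm, mul_div_cancel_right₀ _ (pow_ne_zero _ hb0)]
  obtain ⟨A', hA'O, hAA', hA'fg, hreg', hfS, hN'⟩ := hN ⟨hp⟩ k K O A hAO hAfg hfrac hdimA hreg hdim3 hzd f hfA hf
  haveI : IsFractionRing A' K := isFractionRing_of_le' hAA'
  have hmax : (subringCentre A'.toSubring O hA'O).IsMaximal := hzd A'.toSubring hA'O (fun x hx => hAA' hx)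
  haveI : IsRegularLocalRing ↥(locAtCentre A'.toSubring O) := hreg'
  exact concl_of_looseCleanRep (hreg' := hreg') hp O A A' hA'O hAA' hA'fg g₀ b hb0
    (hR ⟨hp⟩ k K O A' hA'O hA'fg inferInstance hmax hreg' f hfS hf hN')

/-- **THE `k̄`-SLICE OF THE WHOLE `cleanLU3` (Sketch.lean :279) MODULO THE GLOBAL PRINT THEOREM ALONE**: statement = :279–297 VERBATIM
with the single extra binder `[IsAlgClosed k]`; hypothesis `Cossart1987Thm` (§7).  Over `k̄` this one theorem replaces, at the node
`cleanLU3_of_stubs`, the inputs CJS 2020 Cor. 1.5, ✓ `cleanLU3_of_isMin_pthPowerApprox`, ✓ `cleanLU3_of_transcendenceDefect_eq_zero`,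
✓ `cleanLU3DefectArc_of_discrete` and the research stub :219. [folklore] -/
theorem cleanLU3_algClosed_of_cossart1987Thm (p : ℕ) (h : Cossart1987Thm) :
    p.Prime →
    ∀ (k : Type) [Field k] [CharP k p] [IsAlgClosed k] (K : Type) [Field K] [Algebra k K]
    (O : ValuationSubring K) (A : Subalgebra k K), A.toSubring ≤ O.toSubring → A.FG → IsFractionRing A K →
    ringKrullDim A ≤ 3 → IsRegularLocalRing (locAtCentre A.toSubring O) →
    ringKrullDim (locAtCentre A.toSubring O) = 3 →
    (∀ (T : Subring K) (hT : T ≤ O.toSubring), A.toSubring ≤ T → (subringCentre T O hT).IsMaximal) →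
    ∀ g₀ : K, (∀ c : K, c ^ p ≠ g₀) →
    ∃ (A' : Subalgebra k K), A'.toSubring ≤ O.toSubring ∧ A ≤ A' ∧ A'.FG ∧
    ∃ (_ : IsRegularLocalRing (locAtCentre A'.toSubring O)) (c : Fin p → K), (∃ j : Fin p, (j : ℕ) ≠ 0 ∧ c j ≠ 0) ∧
    ((∃ (d m : ℕ) (hmd : m ≤ d) (t : Fin d → ↥(locAtCentre A'.toSubring O)) (a : Fin m → ℕ) (u : ↥(locAtCentre A'.toSubring O)), IsUnit u ∧
    Ideal.span (Set.range t) = IsLocalRing.maximalIdeal ↥(locAtCentre A'.toSubring O) ∧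
    ringKrullDim ↥(locAtCentre A'.toSubring O) = (d : WithBot ℕ∞) ∧ 0 < m ∧ (∀ i, ¬ p ∣ a i) ∧
    (∑ j : Fin p, c j ^ p * g₀ ^ (j : ℕ)) = (u : K) * ∏ i : Fin m, ((t (Fin.castLE hmd i) : ↥(locAtCentre A'.toSubring O)) : K) ^ (a i)) ∨
    (∃ u : ↥(locAtCentre A'.toSubring O), IsUnit u ∧ (∑ j : Fin p, c j ^ p * g₀ ^ (j : ℕ)) = (u : K) ∧
    ∀ c' : ↥(locAtCentre A'.toSubring O), u - c' ^ p ∉ IsLocalRing.maximalIdeal ↥(locAtCentre A'.toSubring O)) ∨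
    (∃ s c' : ↥(locAtCentre A'.toSubring O), (∑ j : Fin p, c j ^ p * g₀ ^ (j : ℕ)) = (s : K) ∧
    s - c' ^ p ∈ IsLocalRing.maximalIdeal ↥(locAtCentre A'.toSubring O) ∧
    s - c' ^ p ∉ IsLocalRing.maximalIdeal ↥(locAtCentre A'.toSubring O) ^ 2)) :=
  cleanLU3_algClosed_of_nuZero p (cossart1987NuZeroAlongValuationAt_of_thm p h) (nuZeroReadOffAlongValuationAt_holds p)


/-! ## 12. Propagation one node up (rev 10): a `k`-FIBRED form of ✓ `cleanCharts3_of_cleanLU3ZeroDim` and CLEAN CHARTS over `k̄` modulo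
`Cossart1987Thm`

The landed stub 4a ✓ `cleanCharts3_of_cleanLU3ZeroDim` (`Theorems/RadicialJungCleanModelsCleanCharts3ZeroDim.lean`) asks its input `hLU` for
ALL fields `k` but uses it only at the field of the conclusion (l.79).  `cleanCharts3ZeroDim_fibred` below is the SAME theorem with `k` (and `p`,
`K`) FIXED — hypothesis and conclusion at that `k` — and the landed proof VERBATIM (lead res-B-lead-1 g2, ✓ p669538 / the ZeroDim variant); it is
the refactor suggested in the memo §3 (f).  Consequence: the `k̄`-anchor of §11 propagates to CLEAN CHARTS:
`cleanCharts3_algClosed_of_cossart1987Thm (h : Cossart1987Thm)` = the conclusion of stub 4a verbatim with `[IsAlgClosed k]`, modulo the global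
print theorem alone.  OURS (re-organisation of a landed proof); counted 0; nothing here proves resolution in characteristic `p`.
-/

/-- `k`-FIBRED stub 4a (the landed ✓ `cleanCharts3_of_cleanLU3ZeroDim` with `p`, `k`, `K` fixed: clean local uniformization at the
zero-dimensional valuation rings of THIS `K/k` ⇒ clean charts for THIS `K/k`).  Proof = the landed proof verbatim.
[cite: Piltant2013, §2 Axiom 5 and Axiom 1] -/
theorem cleanCharts3ZeroDim_fibred (p : ℕ) (hp : p.Prime) (k : Type) [Field k] [CharP k p] (K : Type) [Field K] [Algebra k K]
    (hLU : ∀ (O : ValuationSubring K) (A : Subalgebra k K), A.toSubring ≤ O.toSubring → A.FG → IsFractionRing A K →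
    ringKrullDim A ≤ 3 → IsRegularLocalRing (locAtCentre A.toSubring O) →
    ringKrullDim (locAtCentre A.toSubring O) = 3 →
    (∀ (T : Subring K) (hT : T ≤ O.toSubring), A.toSubring ≤ T → (subringCentre T O hT).IsMaximal) →
    ∀ g₀ : K, (∀ c : K, c ^ p ≠ g₀) →
    ∃ (A' : Subalgebra k K), A'.toSubring ≤ O.toSubring ∧ A ≤ A' ∧ A'.FG ∧
    ∃ (_ : IsRegularLocalRing (locAtCentre A'.toSubring O)) (c : Fin p → K), (∃ j : Fin p, (j : ℕ) ≠ 0 ∧ c j ≠ 0) ∧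
    ((∃ (d m : ℕ) (hmd : m ≤ d) (t : Fin d → ↥(locAtCentre A'.toSubring O)) (a : Fin m → ℕ) (u : ↥(locAtCentre A'.toSubring O)), IsUnit u ∧
    Ideal.span (Set.range t) = IsLocalRing.maximalIdeal ↥(locAtCentre A'.toSubring O) ∧
    ringKrullDim ↥(locAtCentre A'.toSubring O) = (d : WithBot ℕ∞) ∧ 0 < m ∧ (∀ i, ¬ p ∣ a i) ∧
    (∑ j : Fin p, c j ^ p * g₀ ^ (j : ℕ)) = (u : K) * ∏ i : Fin m, ((t (Fin.castLE hmd i) : ↥(locAtCentre A'.toSubring O)) : K) ^ (a i)) ∨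
    (∃ u : ↥(locAtCentre A'.toSubring O), IsUnit u ∧ (∑ j : Fin p, c j ^ p * g₀ ^ (j : ℕ)) = (u : K) ∧
    ∀ c' : ↥(locAtCentre A'.toSubring O), u - c' ^ p ∉ IsLocalRing.maximalIdeal ↥(locAtCentre A'.toSubring O)) ∨
    (∃ s c' : ↥(locAtCentre A'.toSubring O), (∑ j : Fin p, c j ^ p * g₀ ^ (j : ℕ)) = (s : K) ∧
    s - c' ^ p ∈ IsLocalRing.maximalIdeal ↥(locAtCentre A'.toSubring O) ∧
    s - c' ^ p ∉ IsLocalRing.maximalIdeal ↥(locAtCentre A'.toSubring O) ^ 2)))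
    (O : ValuationSubring K) (A : Subalgebra k K) (hAO : A.toSubring ≤ O.toSubring) (hAfg : A.FG) (hfrac : IsFractionRing A K)
    (hdimA : ringKrullDim A ≤ 3)
    (hmax : ∀ (𝔪 : Ideal A.toSubring) [𝔪.IsMaximal],
      IsRegularLocalRing (Localization.AtPrime 𝔪) ∧ ringKrullDim (Localization.AtPrime 𝔪) = 3)
    (g₀ : K) (hg₀ : ∀ c : K, c ^ p ≠ g₀) :
    ∃ T : Subalgebra k K, T.FG ∧ A ≤ T ∧ T.toSubring ≤ O.toSubring ∧
      ∀ O' : ValuationSubring K, T.toSubring ≤ O'.toSubring →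
        CleanRegAt p (locAtCentre T.toSubring O').subtype g₀ := by
  classical
  haveI : Fact p.Prime := ⟨hp⟩
  haveI : CharP K p := charP_of_injective_algebraMap (algebraMap k K).injective p
  -- (1) a zero-dimensional refinement `A ⊆ O₀ ≤ O`
  obtain ⟨O₀, hO₀O, hAO₀, hzd⟩ := exists_zeroDim_refinement O A.toSubring hAO
  -- (2) its centre on `A` is maximal: `A_𝔭` regular of dimension `3`
  haveI h𝔪 : (subringCentre A.toSubring O₀ hAO₀).IsMaximal := hzd A.toSubring hAO₀ le_rfl
  obtain ⟨hreg𝔪, hdim𝔪⟩ := hmax (subringCentre A.toSubring O₀ hAO₀)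
  have hregO₀ : IsRegularLocalRing (locAtCentre A.toSubring O₀) :=
    (isRegularLocalRing_locAtCentre_iff hAO₀).mpr hreg𝔪
  have hdimO₀ : ringKrullDim (locAtCentre A.toSubring O₀) = 3 := by
    rw [← ringKrullDim_eq_of_ringEquiv (locAtCentreEquiv hAO₀).toRingEquiv]; exact hdim𝔪
  -- (3) clean local uniformization at `O₀`
  obtain ⟨A', hA'O₀, hAA', hA'fg, hregR, c, hc, hloose⟩ :=
    hLU O₀ A hAO₀ hAfg hfrac hdimA hregO₀ hdimO₀ hzd g₀ hg₀
  have hAA's : A.toSubring ≤ A'.toSubring := fun x hx => hAA' hx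
  have h𝔭' : (subringCentre A'.toSubring O₀ hA'O₀).IsMaximal := hzd A'.toSubring hA'O₀ hAA's
  have hX : LooseCleanForm p (locAtCentre A'.toSubring O₀).subtype (∑ j : Fin p, c j ^ p * g₀ ^ (j : ℕ)) :=
    looseCleanForm_of_forms hloose
  -- (4) spread from the closed centre
  obtain ⟨h₂, c', hh₂, hc', H⟩ := exists_spread_of_looseCleanForm A' O₀ hA'O₀ hA'fg h𝔭' hregR g₀ c hc hX
  -- (5) the regular locus of `A'` is open: a basic open `D(h₁) ∋ 𝔭'` inside it
  letI : Algebra k A'.toSubring := inferInstanceAs (Algebra k A')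
  haveI : Algebra.FiniteType k A'.toSubring := (A'.fg_iff_finiteType.mp hA'fg : Algebra.FiniteType k A')
  have hopen : IsOpen (regularLocus A'.toSubring) := (isJ2Ring_of_field k).2 A'.toSubring inferInstance
  have hmemReg : (⟨subringCentre A'.toSubring O₀ hA'O₀, inferInstance⟩ : PrimeSpectrum A'.toSubring) ∈
      regularLocus A'.toSubring := (isRegularLocalRing_locAtCentre_iff hA'O₀).mp hregR
  obtain ⟨_, ⟨h₁, rfl⟩, h𝔭'h₁, hsub⟩ :=
    PrimeSpectrum.isTopologicalBasis_basic_opens.exists_subset_of_mem_open hmemReg hopen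
  have hh₁ : h₁ ∉ subringCentre A'.toSubring O₀ hA'O₀ := (PrimeSpectrum.mem_basicOpen _ _).mp h𝔭'h₁
  -- (6) the element to invert
  have hhh : h₁ * h₂ ∉ subringCentre A'.toSubring O₀ hA'O₀ := fun hmem =>
    ((Ideal.IsPrime.mem_or_mem inferInstance hmem).elim hh₁ hh₂)
  have hhh0 : ((h₁ * h₂ : A'.toSubring) : K) ≠ 0 := ne_zero_of_not_mem_subringCentre A' O₀ hA'O₀ hhh
  have hvhh : O₀.valuation ((h₁ * h₂ : A'.toSubring) : K) = 1 := valuation_eq_one_of_not_mem_subringCentre hA'O₀ hhh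
  have hinvO₀ : ((h₁ * h₂ : A'.toSubring) : K)⁻¹ ∈ O₀ := by
    rw [← O₀.valuation_le_one_iff, map_inv₀, hvhh, inv_one]
  -- (7) the chart `T = A'[1/(h₁h₂)]`
  obtain ⟨s, hs⟩ := hA'fg
  let T : Subalgebra k K := Algebra.adjoin k (insert ((h₁ * h₂ : A'.toSubring) : K)⁻¹ (↑s : Set K))
  have hA'T : A' ≤ T := by
    rw [← hs]; exact Algebra.adjoin_mono (Set.subset_insert _ _)
  have hTfg : T.FG := ⟨insert ((h₁ * h₂ : A'.toSubring) : K)⁻¹ s, by rw [Finset.coe_insert]⟩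
  -- `T ⊆ O₀`
  let O₀alg : Subalgebra k K :=
    { O₀.toSubring.toSubsemiring with
      algebraMap_mem' := fun r => hA'O₀ (A'.algebraMap_mem r) }
  have hTO₀ : T.toSubring ≤ O₀.toSubring := by
    have hle : T ≤ O₀alg := by
      refine Algebra.adjoin_le (Set.insert_subset hinvO₀ fun x hx => ?_)
      exact hA'O₀ (hs ▸ Algebra.subset_adjoin hx : x ∈ A')
    exact fun x hx => hle hx
  refine ⟨T, hTfg, hAA'.trans hA'T, fun x hx => hO₀O (hTO₀ hx), fun O' hTO' => ?_⟩
  -- (8) clean-regularity at the centre of an arbitrary `O' ⊇ T`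
  have hA'O' : A'.toSubring ≤ O'.toSubring := fun x hx => hTO' (hA'T hx)
  have hinvO' : ((h₁ * h₂ : A'.toSubring) : K)⁻¹ ∈ O' := hTO' (Algebra.subset_adjoin (Set.mem_insert _ _))
  have hvhh' : O'.valuation ((h₁ * h₂ : A'.toSubring) : K) = 1 :=
    valuation_eq_one_of_inv_mem hhh0 (hA'O' (h₁ * h₂).2) hinvO'
  have hhh𝔮 : h₁ * h₂ ∉ subringCentre A'.toSubring O' hA'O' := by
    rw [mem_subringCentre_iff, hvhh']; exact lt_irrefl 1
  have hh₁𝔮 : h₁ ∉ subringCentre A'.toSubring O' hA'O' := fun hmem => hhh𝔮 (Ideal.mul_mem_right _ _ hmem)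
  have hh₂𝔮 : h₂ ∉ subringCentre A'.toSubring O' hA'O' := fun hmem => hhh𝔮 (Ideal.mul_mem_left _ _ hmem)
  -- `locAtCentre T O' = locAtCentre A' O'`
  let Lalg : Subalgebra k K :=
    { (locAtCentre A'.toSubring O').toSubsemiring with
      algebraMap_mem' := fun r => le_locAtCentre A'.toSubring O' (A'.algebraMap_mem r) }
  have hTloc : T.toSubring ≤ locAtCentre A'.toSubring O' := by
    have hle : T ≤ Lalg := by
      refine Algebra.adjoin_le (Set.insert_subset ?_ fun x hx => ?_)
      · exact inv_mem_locAtCentre (le_locAtCentre A'.toSubring O' (h₁ * h₂).2) hvhh'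
      · exact le_locAtCentre A'.toSubring O' (hs ▸ Algebra.subset_adjoin hx : x ∈ A')
    exact fun x hx => hle hx
  rw [locAtCentre_eq_of_le_of_le (fun x hx => hA'T hx) hTloc]
  -- regularity at the centre `𝔮` of `O'` on `A'`
  have hreg𝔮 : IsRegularLocalRing (Localization.AtPrime (subringCentre A'.toSubring O' hA'O')) :=
    hsub ((PrimeSpectrum.mem_basicOpen _ ⟨subringCentre A'.toSubring O' hA'O', inferInstance⟩).mpr hh₁𝔮)
  haveI hregR' : IsRegularLocalRing (locAtCentre A'.toSubring O') :=
    (isRegularLocalRing_locAtCentre_iff hA'O').mpr hreg𝔮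
  by_cases h𝔮 : subringCentre A'.toSubring O' hA'O' = subringCentre A'.toSubring O₀ hA'O₀
  · -- same centre as `O₀`: same local ring, the original representative is clean there
    rw [locAtCentre_eq_of_subringCentre_eq hA'O' hA'O₀ h𝔮]
    exact ⟨hregR, c, hc, hX⟩
  · -- another centre off `h₁ h₂`: the spread
    haveI := isLocalization_locAtCentre hA'O'
    have H' := H (subringCentre A'.toSubring O' hA'O') hh₂𝔮 h𝔮 (locAtCentre A'.toSubring O')
    exact ⟨hregR', c', hc', H'⟩


/-- **CLEAN CHARTS over `k̄` modulo Cossart 1987** (rev 10): the conclusion of the landed stub 4a ✓ `cleanCharts3_of_cleanLU3ZeroDim`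
VERBATIM with the one extra binder `[IsAlgClosed k]` — for every prime `p`, every regular affine threefold chart `A` of `K/k̄` and
every valuation ring `O ⊇ A`, a finitely generated `T`, `A ⊆ T ⊆ O`, with `g₀` clean-regular at the centre of EVERY valuation ring
containing `T` — from `Cossart1987Thm` alone (§11 `cleanLU3_algClosed_of_cossart1987Thm` fed to the `k`-fibred stub 4a).
OURS; counted 0; nothing here proves resolution in characteristic `p`. [cite: Posva2024 arXiv:2405.05735, App. A §A.1.3; Cossart1987;
Piltant2013, §2] -/
theorem cleanCharts3_algClosed_of_cossart1987Thm (h : Cossart1987Thm) :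
    ∀ (p : ℕ), p.Prime → ∀ (k : Type) [Field k] [CharP k p] [IsAlgClosed k] (K : Type) [Field K] [Algebra k K]
      (O : ValuationSubring K) (A : Subalgebra k K), A.toSubring ≤ O.toSubring → A.FG → IsFractionRing A K →
      ringKrullDim A ≤ 3 →
      (∀ (𝔪 : Ideal A.toSubring) [𝔪.IsMaximal],
        IsRegularLocalRing (Localization.AtPrime 𝔪) ∧ ringKrullDim (Localization.AtPrime 𝔪) = 3) →
      ∀ g₀ : K, (∀ c : K, c ^ p ≠ g₀) →
      ∃ T : Subalgebra k K, T.FG ∧ A ≤ T ∧ T.toSubring ≤ O.toSubring ∧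
        ∀ O' : ValuationSubring K, T.toSubring ≤ O'.toSubring →
          CleanRegAt p (locAtCentre T.toSubring O').subtype g₀ := by
  intro p hp k _ _ _ K _ _ O A hAO hAfg hfrac hdimA hmax g₀ hg₀
  exact cleanCharts3ZeroDim_fibred p hp k K
    (fun O A hAO hAfg hfrac hdimA hreg hdim hzd g₀ hg₀ =>
      cleanLU3_algClosed_of_cossart1987Thm p h hp k K O A hAO hAfg hfrac hdimA hreg hdim hzd g₀ hg₀)
    O A hAO hAfg hfrac hdimA hmax g₀ hg₀


/-! ## 13. ALL ground fields at once (rev 11): the ABSOLUTE-derivation form of the missing input — ONE research Prop for every `k` — and its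
kernel composition to the whole :279 node and to clean charts

`NuZeroAt` (§5) is typed with ABSOLUTE derivations `Der_ℤ(S)`.  Over `k̄` or a perfect `k` these are the `k`-derivations (a derivation kills
`k = k^p`); over an IMPERFECT `k` they include the derivations of the constants — precisely Cossart–Piltant's «differentially finite over a perfect
subfield `k₀`» frame (`Ω_{S/k₀}(log E)`; CP II = hal-00139445 ch. 1: II.3 p. 33 «`𝒥(f,E) := (𝒟 f)`, `J(f,E) := H(x)⁻¹ 𝒥(f,E)`,
`ν(x) := ord_x J(f,E)`» with `𝒟` the `k₀`-derivations logarithmic along `E`, and II.4 p. 38: in the purely inseparable case `g = 0`,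
`ω(x) = ord J(f_X, E)` — so their `ω(x) = 0` is exactly «`𝒥(f,E)` is the principal monomial ideal `(H(x))`» = `NuZeroAt` here, cf. II.4.5 p. 41).  The read-off LEMMA G (§8–§9, ✓ `nuZeroReadOffAlongValuationAt_holds`) is proved for EVERY field.  Hence ONE research Prop,
`AbsNuZeroAlongValuationAt p` (the binders of `Cossart1987NuZeroAlongValuationAt` with NO condition on `k`), covers every ground field, and the kernel
gives from it the whole :279 node and clean charts for ALL `k` (`cleanLU3_of_absNuZero`, `cleanCharts3_of_absNuZero` — statements = Sketch :279 /
✓ `cleanCharts3_of_cleanLU3ZeroDim` VERBATIM, no extra binder).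

STATUS of `AbsNuZeroAlongValuationAt p` by field class (memo §5–§6): `k = k̄` — PRINT (it is `Cossart1987NuZeroAlongValuationAt p`, obtained from
`Cossart1987Thm` in §10: `cossart1987NuZero_of_abs` is the trivial direction, `cossart1987NuZeroAlongValuationAt_of_thm` the print one);
`k` perfect, `k ≠ k̄` — it is F-eq (§6), OPEN;  `k` imperfect — OPEN: CP II drives the same `ω` along a rank-1 zero-dimensional `μ` over every
differentially finite `k` but EXITS at «`ord_x h < p`» (pp. 14–15: `ι(x) = (ord_x h, Ω(x))` drops; «the case `ω(x) = 0` is easily dealt with in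
II.4.6 by a simple combinatorial algorithm (Hironaka's game)», i.e. from `ω = 0` they CONTINUE to `ord h < p`), so print guarantees the end state
`ord(f − θ^p) < p`, not `ω = 0`, along `μ`; only an `ω = 0` stage is `NuZeroAt` —
for `p = 2` the other exit is already clean (lineage g6), for odd `p` it is the lineage's open «LowMultToClean».  So over EVERY field the
zero-dimensional LU node of rung B's bypass route reads «`AbsNuZeroAlongValuationAt p` + kernel», and `AbsNuZeroAlongValuationAt p` is what BOTH
sibling algorithms (Cossart 1987 over `k̄`; CP II's `ω` over d.f. `k`) actually control — the lens-5 dictionary at this node in one line.  It is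
slightly STRONGER than :279 (`ν = 0` ⇒ loosely clean by LEMMA G; conversely a form-(1) representative gives `ν = 0` for a suitable boundary), i.e. a
research target that EXPOSES the controlled invariant, not a costume of :219.  OURS; OPEN off `k̄`; counted 0.
-/

/-- RESEARCH PROP (OURS; PRINT exactly over `k̄` (= `Cossart1987NuZeroAlongValuationAt p`), OPEN otherwise) — **absolute `ν = 0` along a
zero-dimensional valuation with 3-dimensional regular centre, over an ARBITRARY ground field of characteristic `p`**: the binders of
`Cossart1987NuZeroAlongValuationAt` with no condition on `k` (`NuZeroAt` uses `Der_ℤ`, i.e. derivations over the constants too).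
[conjecture: lens-5 g11, memo KBAR-anchor-Cossart87 §5–§6 «F-abs»] -/
def AbsNuZeroAlongValuationAt (p : ℕ) : Prop :=
  ∀ (_ : Fact p.Prime) (k : Type) [Field k] [CharP k p] (K : Type) [Field K] [Algebra k K]
    (O : ValuationSubring K) (A : Subalgebra k K), A.toSubring ≤ O.toSubring → A.FG → IsFractionRing A K →
    ringKrullDim A ≤ 3 → IsRegularLocalRing (locAtCentre A.toSubring O) →
    ringKrullDim (locAtCentre A.toSubring O) = 3 →
    (∀ (T : Subring K) (hT : T ≤ O.toSubring), A.toSubring ≤ T → (subringCentre T O hT).IsMaximal) →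
    ∀ f : K, f ∈ A → (∀ c : K, c ^ p ≠ f) →
    ∃ (A' : Subalgebra k K), A'.toSubring ≤ O.toSubring ∧ A ≤ A' ∧ A'.FG ∧
    ∃ (_ : IsRegularLocalRing (locAtCentre A'.toSubring O)) (hf : f ∈ locAtCentre A'.toSubring O),
      NuZeroAt (⟨f, hf⟩ : ↥(locAtCentre A'.toSubring O))

/-- `k̄` slice of F-abs = the literal Cossart-1987-along-`v` shape (trivial direction). [folklore] -/
theorem cossart1987NuZero_of_abs (p : ℕ) (h : AbsNuZeroAlongValuationAt p) :
    Cossart1987NuZeroAlongValuationAt p := by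
  intro hp k _ _ _ K _ _ O A hAO hAfg hfrac hdimA hreg hdim3 hzd f hfA hf
  exact h hp k K O A hAO hAfg hfrac hdimA hreg hdim3 hzd f hfA hf

/-- Perfect slice of F-abs = F-eq (§6) (trivial direction). [folklore] -/
theorem cossartNuZeroPerfect_of_abs (p : ℕ) (h : AbsNuZeroAlongValuationAt p) :
    CossartNuZeroAlongValuationAtPerfect p := by
  intro hp k _ _ _ K _ _ O A hAO hAfg hfrac hdimA hreg hdim3 hzd f hfA hf
  exact h hp k K O A hAO hAfg hfrac hdimA hreg hdim3 hzd f hfA hf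

/-- **THE WHOLE :279 NODE OVER EVERY FIELD from F-abs alone** — statement = Sketch.lean :279–297 (`cleanLU3_of_stubs`) VERBATIM, NO extra
binder; hypothesis the research Prop `AbsNuZeroAlongValuationAt p`; the read-off is ✓ LEMMA G (every `k`). Kernel composition. [folklore] -/
theorem cleanLU3_of_absNuZero (p : ℕ) (hN : AbsNuZeroAlongValuationAt p) :
    p.Prime →
    ∀ (k : Type) [Field k] [CharP k p] (K : Type) [Field K] [Algebra k K]
    (O : ValuationSubring K) (A : Subalgebra k K), A.toSubring ≤ O.toSubring → A.FG → IsFractionRing A K →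
    ringKrullDim A ≤ 3 → IsRegularLocalRing (locAtCentre A.toSubring O) →
    ringKrullDim (locAtCentre A.toSubring O) = 3 →
    (∀ (T : Subring K) (hT : T ≤ O.toSubring), A.toSubring ≤ T → (subringCentre T O hT).IsMaximal) →
    ∀ g₀ : K, (∀ c : K, c ^ p ≠ g₀) →
    ∃ (A' : Subalgebra k K), A'.toSubring ≤ O.toSubring ∧ A ≤ A' ∧ A'.FG ∧
    ∃ (_ : IsRegularLocalRing (locAtCentre A'.toSubring O)) (c : Fin p → K), (∃ j : Fin p, (j : ℕ) ≠ 0 ∧ c j ≠ 0) ∧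
    ((∃ (d m : ℕ) (hmd : m ≤ d) (t : Fin d → ↥(locAtCentre A'.toSubring O)) (a : Fin m → ℕ) (u : ↥(locAtCentre A'.toSubring O)), IsUnit u ∧
    Ideal.span (Set.range t) = IsLocalRing.maximalIdeal ↥(locAtCentre A'.toSubring O) ∧
    ringKrullDim ↥(locAtCentre A'.toSubring O) = (d : WithBot ℕ∞) ∧ 0 < m ∧ (∀ i, ¬ p ∣ a i) ∧
    (∑ j : Fin p, c j ^ p * g₀ ^ (j : ℕ)) = (u : K) * ∏ i : Fin m, ((t (Fin.castLE hmd i) : ↥(locAtCentre A'.toSubring O)) : K) ^ (a i)) ∨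
    (∃ u : ↥(locAtCentre A'.toSubring O), IsUnit u ∧ (∑ j : Fin p, c j ^ p * g₀ ^ (j : ℕ)) = (u : K) ∧
    ∀ c' : ↥(locAtCentre A'.toSubring O), u - c' ^ p ∉ IsLocalRing.maximalIdeal ↥(locAtCentre A'.toSubring O)) ∨
    (∃ s c' : ↥(locAtCentre A'.toSubring O), (∑ j : Fin p, c j ^ p * g₀ ^ (j : ℕ)) = (s : K) ∧
    s - c' ^ p ∈ IsLocalRing.maximalIdeal ↥(locAtCentre A'.toSubring O) ∧
    s - c' ^ p ∉ IsLocalRing.maximalIdeal ↥(locAtCentre A'.toSubring O) ^ 2)) := by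
  intro hp k _ _ K _ _ O A hAO hAfg hfrac hdimA hreg hdim3 hzd g₀ hg₀
  classical
  haveI : Fact p.Prime := ⟨hp⟩
  haveI := hfrac
  obtain ⟨b, hb0, hbA, hfA⟩ := exists_pow_mul_mem p hp A g₀
  set f : K := b ^ p * g₀ with hfdef
  have hf : ∀ c : K, c ^ p ≠ f := by
    intro c hc
    apply hg₀ (c / b)
    rw [div_pow, hc, hfdef, mul_comm, mul_div_cancel_right₀ _ (pow_ne_zero _ hb0)]
  obtain ⟨A', hA'O, hAA', hA'fg, hreg', hfS, hN'⟩ := hN ⟨hp⟩ k K O A hAO hAfg hfrac hdimA hreg hdim3 hzd f hfA hf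
  haveI : IsFractionRing A' K := isFractionRing_of_le' hAA'
  have hmax : (subringCentre A'.toSubring O hA'O).IsMaximal := hzd A'.toSubring hA'O (fun x hx => hAA' hx)
  haveI : IsRegularLocalRing ↥(locAtCentre A'.toSubring O) := hreg'
  exact concl_of_looseCleanRep (hreg' := hreg') hp O A A' hA'O hAA' hA'fg g₀ b hb0
    (nuZeroReadOffAlongValuationAt_holds p ⟨hp⟩ k K O A' hA'O hA'fg inferInstance hmax hreg' f hfS hf hN')

/-- **CLEAN CHARTS OVER EVERY FIELD from F-abs alone** — statement = ✓ `cleanCharts3_of_cleanLU3ZeroDim`'s conclusion VERBATIM (one prime `p`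
at a time), NO extra binder; via the `k`-fibred stub 4a (§12). Kernel composition. [folklore] -/
theorem cleanCharts3_of_absNuZero (p : ℕ) (hN : AbsNuZeroAlongValuationAt p) :
    p.Prime → ∀ (k : Type) [Field k] [CharP k p] (K : Type) [Field K] [Algebra k K]
      (O : ValuationSubring K) (A : Subalgebra k K), A.toSubring ≤ O.toSubring → A.FG → IsFractionRing A K →
      ringKrullDim A ≤ 3 →
      (∀ (𝔪 : Ideal A.toSubring) [𝔪.IsMaximal],
        IsRegularLocalRing (Localization.AtPrime 𝔪) ∧ ringKrullDim (Localization.AtPrime 𝔪) = 3) →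
      ∀ g₀ : K, (∀ c : K, c ^ p ≠ g₀) →
      ∃ T : Subalgebra k K, T.FG ∧ A ≤ T ∧ T.toSubring ≤ O.toSubring ∧
        ∀ O' : ValuationSubring K, T.toSubring ≤ O'.toSubring →
          CleanRegAt p (locAtCentre T.toSubring O').subtype g₀ := by
  intro hp k _ _ K _ _ O A hAO hAfg hfrac hdimA hmax g₀ hg₀
  exact cleanCharts3ZeroDim_fibred p hp k K
    (fun O A hAO hAfg hfrac hdimA hreg hdim hzd g₀ hg₀ =>
      cleanLU3_of_absNuZero p hN hp k K O A hAO hAfg hfrac hdimA hreg hdim hzd g₀ hg₀)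
    O A hAO hAfg hfrac hdimA hmax g₀ hg₀


/-! ## 14. Alignment with Sketch rev 25 (re-registered 2026-08-29T11:59:49Z, sha16 3b936b273599a7ba, 501 l.)

Rev 25 of the lead's skeleton NARROWS the research stub: `stub_cleanLU3DefectNonDiscrete` (now :238–266) = the rev-20/24 statement (:219–242, the one
quoted in §3/§5/§10 above) PLUS one hypothesis `hdiv` «`O` has NO divisorial coarsening» (the (C-div) slice being kernel-closed, ✓
`cleanLU3Defect_of_divisorialCoarsening`); the rev-24 statement survives verbatim as the composition `cleanLU3DefectNonDiscrete_of_stubs` (:268), and the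
node `cleanLU3_of_stubs` (§11/§13's target) is now :334–352 with its statement BYTE-IDENTICAL to rev 24 :279–297.  So every theorem above stands as
stated (rev-24 numbering), and the narrowed rev-25 stub follows A FORTIORI by discarding `hdiv`:
-/

/-- **Sketch rev 25 :238 (`stub_cleanLU3DefectNonDiscrete`, narrowed by `hdiv`) VERBATIM + `[IsAlgClosed k]`, modulo `Cossart1987Thm` alone** —
from §10 by discarding the four class hypotheses. [folklore] -/
theorem cleanLU3DefectNonDiscrete25_algClosed_of_cossart1987Thm (p : ℕ) (h : Cossart1987Thm) :
    p.Prime →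
    ∀ (k : Type) [Field k] [CharP k p] [IsAlgClosed k] (K : Type) [Field K] [Algebra k K]
    (O : ValuationSubring K) (A : Subalgebra k K), A.toSubring ≤ O.toSubring → A.FG → IsFractionRing A K →
    ringKrullDim A ≤ 3 → IsRegularLocalRing (locAtCentre A.toSubring O) →
    ringKrullDim (locAtCentre A.toSubring O) = 3 →
    (∀ (T : Subring K) (hT : T ≤ O.toSubring), A.toSubring ≤ T → (subringCentre T O hT).IsMaximal) →
    ∀ g₀ : K, (∀ c : K, c ^ p ≠ g₀) →
    (∀ f₀ : K, ∃ f₁ : K, O.valuation (g₀ - f₁ ^ p) < O.valuation (g₀ - f₀ ^ p)) →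
    (∀ hk : ∀ c : k, algebraMap k K c ∈ O, transcendenceDefect k O hk ≠ 0) →
    ¬ (∃ π : K, π ≠ 0 ∧ (∀ x : K, O.valuation x < 1 → O.valuation x ≤ O.valuation π) ∧
      (∀ x : K, x ≠ 0 → ∃ n : ℕ, O.valuation π ^ n ≤ O.valuation x)) →
    ¬ (∃ (O₁ : ValuationSubring K), O ≤ O₁ ∧ O₁ ≠ ⊤ ∧ ∃ y : Fin 2 → K, (∀ i, y i ∈ O) ∧
      ∀ P : MvPolynomial (Fin 2) k, P ≠ 0 → O₁.valuation (MvPolynomial.aeval y P) = 1) →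
    ∃ (A' : Subalgebra k K), A'.toSubring ≤ O.toSubring ∧ A ≤ A' ∧ A'.FG ∧
    ∃ (_ : IsRegularLocalRing (locAtCentre A'.toSubring O)) (c : Fin p → K), (∃ j : Fin p, (j : ℕ) ≠ 0 ∧ c j ≠ 0) ∧
    ((∃ (d m : ℕ) (hmd : m ≤ d) (t : Fin d → ↥(locAtCentre A'.toSubring O)) (a : Fin m → ℕ) (u : ↥(locAtCentre A'.toSubring O)), IsUnit u ∧
    Ideal.span (Set.range t) = IsLocalRing.maximalIdeal ↥(locAtCentre A'.toSubring O) ∧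
    ringKrullDim ↥(locAtCentre A'.toSubring O) = (d : WithBot ℕ∞) ∧ 0 < m ∧ (∀ i, ¬ p ∣ a i) ∧
    (∑ j : Fin p, c j ^ p * g₀ ^ (j : ℕ)) = (u : K) * ∏ i : Fin m, ((t (Fin.castLE hmd i) : ↥(locAtCentre A'.toSubring O)) : K) ^ (a i)) ∨
    (∃ u : ↥(locAtCentre A'.toSubring O), IsUnit u ∧ (∑ j : Fin p, c j ^ p * g₀ ^ (j : ℕ)) = (u : K) ∧
    ∀ c' : ↥(locAtCentre A'.toSubring O), u - c' ^ p ∉ IsLocalRing.maximalIdeal ↥(locAtCentre A'.toSubring O)) ∨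
    (∃ s c' : ↥(locAtCentre A'.toSubring O), (∑ j : Fin p, c j ^ p * g₀ ^ (j : ℕ)) = (s : K) ∧
    s - c' ^ p ∈ IsLocalRing.maximalIdeal ↥(locAtCentre A'.toSubring O) ∧
    s - c' ^ p ∉ IsLocalRing.maximalIdeal ↥(locAtCentre A'.toSubring O) ^ 2))
:= by
  intro hp k _ _ _ K _ _ O A hAO hAfg hfrac hdimA hreg hdim3 hzd g₀ hg₀ _ _ _ _
  exact cleanLU3_algClosed_of_cossart1987Thm p h hp k K O A hAO hAfg hfrac hdimA hreg hdim3 hzd g₀ hg₀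

/-- **Sketch rev 25 :238 VERBATIM, NO extra binder (every field), modulo the research Prop F-abs alone** (§13). [folklore] -/
theorem cleanLU3DefectNonDiscrete25_of_absNuZero (p : ℕ) (hN : AbsNuZeroAlongValuationAt p) :
    p.Prime →
    ∀ (k : Type) [Field k] [CharP k p] (K : Type) [Field K] [Algebra k K]
    (O : ValuationSubring K) (A : Subalgebra k K), A.toSubring ≤ O.toSubring → A.FG → IsFractionRing A K →
    ringKrullDim A ≤ 3 → IsRegularLocalRing (locAtCentre A.toSubring O) →
    ringKrullDim (locAtCentre A.toSubring O) = 3 →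
    (∀ (T : Subring K) (hT : T ≤ O.toSubring), A.toSubring ≤ T → (subringCentre T O hT).IsMaximal) →
    ∀ g₀ : K, (∀ c : K, c ^ p ≠ g₀) →
    (∀ f₀ : K, ∃ f₁ : K, O.valuation (g₀ - f₁ ^ p) < O.valuation (g₀ - f₀ ^ p)) →
    (∀ hk : ∀ c : k, algebraMap k K c ∈ O, transcendenceDefect k O hk ≠ 0) →
    ¬ (∃ π : K, π ≠ 0 ∧ (∀ x : K, O.valuation x < 1 → O.valuation x ≤ O.valuation π) ∧
      (∀ x : K, x ≠ 0 → ∃ n : ℕ, O.valuation π ^ n ≤ O.valuation x)) →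
    ¬ (∃ (O₁ : ValuationSubring K), O ≤ O₁ ∧ O₁ ≠ ⊤ ∧ ∃ y : Fin 2 → K, (∀ i, y i ∈ O) ∧
      ∀ P : MvPolynomial (Fin 2) k, P ≠ 0 → O₁.valuation (MvPolynomial.aeval y P) = 1) →
    ∃ (A' : Subalgebra k K), A'.toSubring ≤ O.toSubring ∧ A ≤ A' ∧ A'.FG ∧
    ∃ (_ : IsRegularLocalRing (locAtCentre A'.toSubring O)) (c : Fin p → K), (∃ j : Fin p, (j : ℕ) ≠ 0 ∧ c j ≠ 0) ∧
    ((∃ (d m : ℕ) (hmd : m ≤ d) (t : Fin d → ↥(locAtCentre A'.toSubring O)) (a : Fin m → ℕ) (u : ↥(locAtCentre A'.toSubring O)), IsUnit u ∧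
    Ideal.span (Set.range t) = IsLocalRing.maximalIdeal ↥(locAtCentre A'.toSubring O) ∧
    ringKrullDim ↥(locAtCentre A'.toSubring O) = (d : WithBot ℕ∞) ∧ 0 < m ∧ (∀ i, ¬ p ∣ a i) ∧
    (∑ j : Fin p, c j ^ p * g₀ ^ (j : ℕ)) = (u : K) * ∏ i : Fin m, ((t (Fin.castLE hmd i) : ↥(locAtCentre A'.toSubring O)) : K) ^ (a i)) ∨
    (∃ u : ↥(locAtCentre A'.toSubring O), IsUnit u ∧ (∑ j : Fin p, c j ^ p * g₀ ^ (j : ℕ)) = (u : K) ∧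
    ∀ c' : ↥(locAtCentre A'.toSubring O), u - c' ^ p ∉ IsLocalRing.maximalIdeal ↥(locAtCentre A'.toSubring O)) ∨
    (∃ s c' : ↥(locAtCentre A'.toSubring O), (∑ j : Fin p, c j ^ p * g₀ ^ (j : ℕ)) = (s : K) ∧
    s - c' ^ p ∈ IsLocalRing.maximalIdeal ↥(locAtCentre A'.toSubring O) ∧
    s - c' ^ p ∉ IsLocalRing.maximalIdeal ↥(locAtCentre A'.toSubring O) ^ 2))
:= by
  intro hp k _ _ K _ _ O A hAO hAfg hfrac hdimA hreg hdim3 hzd g₀ hg₀ _ _ _ _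
  exact cleanLU3_of_absNuZero p hN hp k K O A hAO hAfg hfrac hdimA hreg hdim3 hzd g₀ hg₀

end Summit.ResolutionOfSingularities.ResolutionOfSingularities.Cruxes.DescentPerfectToAll.CpSibling.KbarAnchor

end
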